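import Literature.Probability.LatticeModels.LatticeLaplacian
import Mathlib.Analysis.SpecialFunctions.Arcosh
import Mathlib.Analysis.SpecialFunctions.Trigonometric.Bounds
import Mathlib.Analysis.SpecificLimits.Normed
import HarnessLib

/-!
# Discrete harmonic functions on lattice boxes: separation of variables and interior estimates

Topic `Literature/Probability/LatticeModels`; an instalment (item P1–P2 of the road recorded in
`Sweep1Proofs.lean`, module docstring §2b) of the discharge programme for crit-ising.S18 /
Smirnov's Theorem 2.2 (Ann. of Math. 172 (2010), §5 and Appendix B). Smirnov's Appendix B quotes
the interior regularity of discrete harmonic functions ("Verblunsky's interior gradient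
estimate", Lemma B.1/B.4) from the classical literature; this file proves what the programme
needs, for the nearest-neighbour Laplacian of `LatticeLaplacian.lean`, by the explicit Poisson
kernel of a lattice box obtained by **separation of variables** (Courant–Friedrichs–Lewy 1928, §2;
Lawler–Limic 2010, §8.1 for the eigenfunctions `sin(πkx/N)` of the discrete interval).
Everything is proved; all statements are classical and tagged `[folklore]`.

* **Discrete sine transform** (`sum_cos_pi_mul_div`, `sum_sin_mul_sin`):
  `∑_{i<N} sin(πki/N) sin(πk'i/N) = (N/2)[k = k']` for `1 ≤ k, k' ≤ N-1`, by telescoping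
  `2 sin(θ/2) cos(θ i)`.
* **Mode rates** (`modeRate θ = arcosh(2 - cos θ)`, `cosh_modeRate`): the separable functions
  `sin(θ x₀) sinh(μ(θ) x₁)` are lattice-harmonic (`latticeLaplacian_mul_eq_zero`: products of
  solutions of three-term recurrences with `c + d = 4`); the two-sided comparison
  `c₀|θ| ≤ μ(θ) ≤ |θ|` on `|θ| ≤ π` (`modeRateConst_mul_le`, `modeRate_le_abs`) with
  `c₀ = 2/(π cosh(π/2))`, from `1 - cos θ ≥ (2/π²)θ²`, `μ²/2 ≤ cosh μ - 1 ≤ (μ²/2)cosh²(μ/2)`.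
* **Poisson extension of top-side data** on `[0,N]²` (`topExtension N φ`, coefficients
  `dstCoeff`): lattice-harmonic on all of `ℤ²` (`latticeLaplacian_topExtension`), equal to `φ` on
  the open top side (`topExtension_top`, the sine transform inversion) and to `0` on the other
  three sides; the kernel bounds `|u(x)| ≤ (2C_g/N) ∑|φ|` and
  `|u(x+e_k) - u(x)| ≤ (K/N²) ∑|φ|` on the lower seven eighths of the box
  (`abs_topExtension_le`, `abs_topExtension_step_le`), from `sinh(μj)/sinh(μN) ≤ e^{-μ(N-j)}`,
  `μ_k ≥ c₀πk/N` and geometric sums.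
* **Lattice motions** (`IsLatticeMotion`: maps commuting with lattice steps up to a permutation of
  the four directions) commute with the Laplacian; the four **box maps** transport the top-side
  extension to the four sides of the box `(a₀, a₀+N) × (a₁, a₁+N)` (`boxInterior a N`), whose sum
  `boxPoisson a N h` is harmonic and equals `h` on the outer boundary of the interior
  (`mem_sides_of_mem_latticeOuterBoundary`), hence **represents every function harmonic on the
  box interior** (`eqOn_boxPoisson`, by `isLatticeHarmonicOn_unique`).
* **Interior estimates** (`harmonic_box_estimates`): for `h` harmonic on the interior of a box of
  side `N ≥ 16` and `x` in the middle region (`boxMiddle`), `|h x| ≤ (2C_g/N) ∑_{sides}|h|` and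
  `|h(x+e_k) - h(x)| ≤ (K/N²) ∑_{sides}|h|` (`boxBoundarySum`); under a uniform bound `|h| ≤ M` on
  the sides, `|∇h| ≤ 4KM/N` (`harmonic_box_gradient_le`) — the discrete interior gradient
  estimate (Lawler–Limic 2010, Thm. 6.3.8); and the **`L¹` interior estimate by averaging over
  concentric boxes** (`sub_mul_abs_le_sum`): `(n₂-n₁)|h x| ≤ (4C_g/n₁) ∑_{y∈Q}|h y|` whenever `Q`
  contains the sides of the boxes of radii `n₁ ≤ n < n₂` about `x`.

The constants (`modeRateConst`, `decayRate`, `sinhLower`, `geomConst`, `linGeomConst`,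
`topGradConst`) are explicit closed forms in `π`, `exp`, `cosh`; only their positivity is used
downstream.

## References

* R. Courant, K. Friedrichs, H. Lewy, *Über die partiellen Differenzengleichungen der
  mathematischen Physik*, Math. Ann. 100 (1928) 32–74, §2–§4.
* G. F. Lawler, V. Limic, *Random Walk: A Modern Introduction*, CUP 2010, §6.3 (difference
  estimates), §8.1 (eigenfunctions of the discrete interval / Poisson kernel of rectangles).
* S. Smirnov, Ann. of Math. 172 (2010) 1435–1467, Appendix B (where these estimates are quoted) —
  bib key `Smirnov2010`.
-/

noncomputable section

namespace Literature.Probability.LatticeModels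

open Finset Real

/-! ### Trigonometric sums: orthogonality of the discrete sine transform -/

/-- `2 sin(θ/2) cos(θ x) = sin(θ x + θ/2) - sin(θ x - θ/2)`. [folklore] -/
theorem two_mul_sin_half_mul_cos (θ x : ℝ) :
    2 * sin (θ / 2) * cos (θ * x) = sin (θ * x + θ / 2) - sin (θ * x - θ / 2) := by
  rw [sin_add, sin_sub]; ring

/-- `∑_{i<N} cos(π m i / N) = (1 - (-1)^m)/2` for `0 < m < 2N` (telescoping against `2 sin(θ/2)`,
`θ = π m / N`). [folklore] -/
theorem sum_cos_pi_mul_div {N m : ℕ} (hm : 0 < m) (hmN : m < 2 * N) :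
    ∑ i ∈ range N, cos (π * m * i / N) = (1 - (-1) ^ m) / 2 := by
  have hN : (0:ℝ) < N := by
    have : 0 < N := by omega
    exact_mod_cast this
  set θ : ℝ := π * m / N with hθ
  have hθ2 : 0 < sin (θ / 2) := by
    apply sin_pos_of_pos_of_lt_pi
    · have : (0:ℝ) < m := by exact_mod_cast hm
      positivity
    · have : (m : ℝ) < 2 * N := by exact_mod_cast hmN
      rw [hθ, div_div, div_lt_iff₀ (by positivity)]
      nlinarith [Real.pi_pos]
  have h1 : ∀ i : ℕ, π * m * i / N = θ * i := fun i => by rw [hθ]; ring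
  simp_rw [h1]
  have key : 2 * sin (θ / 2) * ∑ i ∈ range N, cos (θ * i) = sin (θ / 2) * (1 - (-1) ^ m) := by
    rw [Finset.mul_sum]
    set f : ℕ → ℝ := fun j => sin (θ * j - θ / 2) with hf
    have h2 : ∀ i ∈ range N, 2 * sin (θ / 2) * cos (θ * i) = f (i + 1) - f i := by
      intro i _
      rw [two_mul_sin_half_mul_cos, hf]
      push_cast
      ring_nf
    rw [Finset.sum_congr rfl h2, Finset.sum_range_sub f N, hf]
    have h3 : θ * (N : ℕ) - θ / 2 = m * π - θ / 2 := by
      rw [hθ]; field_simp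
    simp only [h3, sin_nat_mul_pi_sub, Nat.cast_zero, mul_zero, zero_sub, sin_neg]
    ring
  have h4 : 2 * sin (θ / 2) ≠ 0 := by positivity
  field_simp at key ⊢
  linarith

/-- **Orthogonality of the discrete sine transform**: for `1 ≤ k, k' ≤ N - 1`,
`∑_{i<N} sin(π k i/N) sin(π k' i/N) = (N/2) [k = k']`. [folklore] -/
theorem sum_sin_mul_sin {N k k' : ℕ} (hk : 0 < k) (hkN : k < N) (hk' : 0 < k') (hk'N : k' < N) :
    ∑ i ∈ range N, sin (π * k * i / N) * sin (π * k' * i / N) = if k = k' then (N : ℝ) / 2 else 0 := by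
  -- reduce to `k' ≤ k`
  wlog hle : k' ≤ k generalizing k k'
  · have := this hk' hk'N hk hkN (by omega)
    simp_rw [mul_comm (sin (π * k * _ / N))]
    rw [this]
    by_cases h : k = k'
    · subst h; simp
    · rw [if_neg (Ne.symm h), if_neg h]
  have hprod : ∀ i : ℕ, sin (π * k * i / N) * sin (π * k' * i / N) =
      (cos (π * ((k - k' : ℕ) : ℝ) * i / N) - cos (π * ((k + k' : ℕ) : ℝ) * i / N)) / 2 := by
    intro i
    have := two_mul_sin_mul_sin (π * k * i / N) (π * k' * i / N)
    push_cast [Nat.cast_sub hle]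
    rw [show π * (k - k') * i / N = π * k * i / N - π * k' * i / N by ring,
      show π * (k + k') * i / N = π * k * i / N + π * k' * i / N by ring]
    linarith
  simp_rw [hprod]
  rw [← Finset.sum_div, Finset.sum_sub_distrib]
  by_cases heq : k = k'
  · subst heq
    rw [if_pos rfl, Nat.sub_self]
    simp only [CharP.cast_eq_zero, mul_zero, zero_mul, zero_div, cos_zero, sum_const, card_range,
      nsmul_eq_mul, mul_one]
    rw [sum_cos_pi_mul_div (m := k + k) (by omega) (by omega)]
    rw [show (-1 : ℝ) ^ (k + k) = 1 by rw [← two_mul, pow_mul]; norm_num]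
    ring
  · rw [if_neg heq]
    have hlt : k' < k := lt_of_le_of_ne hle (Ne.symm heq)
    rw [sum_cos_pi_mul_div (m := k - k') (by omega) (by omega),
      sum_cos_pi_mul_div (m := k + k') (by omega) (by omega)]
    have : (-1 : ℝ) ^ (k - k') = (-1) ^ (k + k') := by
      rw [show k + k' = (k - k') + 2 * k' by omega, pow_add, pow_mul]
      norm_num
    rw [this]
    ring


/-! ### Hyperbolic inequalities and the mode rates `μ(θ)` -/

/-- `sinh x ≤ x cosh x` for `x ≥ 0` (the derivative of `x cosh x - sinh x` is `x sinh x ≥ 0`). [folklore] -/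
theorem sinh_le_mul_cosh {x : ℝ} (hx : 0 ≤ x) : sinh x ≤ x * cosh x := by
  have hmono : MonotoneOn (fun t : ℝ => t * cosh t - sinh t) (Set.Ici 0) := by
    refine monotoneOn_of_deriv_nonneg (convex_Ici 0) ?_ ?_ fun t ht => ?_
    · exact ((continuous_id.mul continuous_cosh).sub continuous_sinh).continuousOn
    · intro t _
      exact (((hasDerivAt_id t).mul (hasDerivAt_cosh t)).sub (hasDerivAt_sinh t)).differentiableAt.differentiableWithinAt
    · rw [interior_Ici, Set.mem_Ioi] at ht
      have hd : HasDerivAt (fun t : ℝ => t * cosh t - sinh t) (1 * cosh t + t * sinh t - cosh t) t :=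
        ((hasDerivAt_id t).mul (hasDerivAt_cosh t)).sub (hasDerivAt_sinh t)
      rw [hd.deriv]
      have : 0 ≤ t * sinh t := mul_nonneg ht.le (sinh_nonneg_iff.2 ht.le)
      linarith
  have := hmono (Set.mem_Ici.2 le_rfl) (Set.mem_Ici.2 hx) hx
  simp only [zero_mul, sinh_zero, sub_zero] at this
  linarith

/-- `cosh x = 1 + 2 sinh²(x/2)`. [folklore] -/
theorem cosh_eq_one_add_two_mul_sinh_sq (x : ℝ) : cosh x = 1 + 2 * sinh (x / 2) ^ 2 := by
  have h := cosh_two_mul (x / 2)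
  rw [show 2 * (x / 2) = x by ring] at h
  rw [h, cosh_sq]
  ring

/-- `x²/2 ≤ cosh x - 1`. [folklore] -/
theorem sq_div_two_le_cosh_sub_one (x : ℝ) : x ^ 2 / 2 ≤ cosh x - 1 := by
  wlog hx : 0 ≤ x generalizing x
  · have := this (-x) (by linarith)
    rwa [neg_sq, cosh_neg] at this
  rw [cosh_eq_one_add_two_mul_sinh_sq]
  have h1 : x / 2 ≤ sinh (x / 2) := self_le_sinh_iff.2 (by linarith)
  have h2 : 0 ≤ x / 2 := by linarith
  nlinarith [mul_le_mul h1 h1 h2 (h2.trans h1)]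

/-- `cosh x - 1 ≤ (x²/2) cosh² (x/2)` for `x ≥ 0`. [folklore] -/
theorem cosh_sub_one_le_sq_mul_cosh_sq (x : ℝ) (hx : 0 ≤ x) : cosh x - 1 ≤ x ^ 2 / 2 * cosh (x / 2) ^ 2 := by
  rw [cosh_eq_one_add_two_mul_sinh_sq]
  have h1 : sinh (x / 2) ≤ x / 2 * cosh (x / 2) := sinh_le_mul_cosh (by linarith)
  have h0 : 0 ≤ sinh (x / 2) := sinh_nonneg_iff.2 (by linarith)
  nlinarith [mul_le_mul h1 h1 h0 (h0.trans h1)]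

/-- The **mode rate** `μ(θ) = arcosh (2 - cos θ) ≥ 0`: the separable functions
`sin(θ x₀) sinh(μ(θ) x₁)` are lattice-harmonic (`2 cos θ + 2 cosh μ = 4`). [folklore] -/
def modeRate (θ : ℝ) : ℝ := arcosh (2 - cos θ)

/-- `1 ≤ 2 - cos θ`. [folklore] -/
theorem one_le_two_sub_cos (θ : ℝ) : 1 ≤ 2 - cos θ := by linarith [cos_le_one θ]

/-- `cosh μ(θ) = 2 - cos θ`. [folklore] -/
theorem cosh_modeRate (θ : ℝ) : cosh (modeRate θ) = 2 - cos θ :=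
  cosh_arcosh (one_le_two_sub_cos θ)

/-- `μ(θ) ≥ 0`. [folklore] -/
theorem modeRate_nonneg (θ : ℝ) : 0 ≤ modeRate θ := arcosh_nonneg (one_le_two_sub_cos θ)

/-- `μ(θ) ≤ |θ|` (from `μ²/2 ≤ cosh μ - 1 = 1 - cos θ ≤ θ²/2`). [folklore] -/
theorem modeRate_le_abs (θ : ℝ) : modeRate θ ≤ |θ| := by
  have h1 := sq_div_two_le_cosh_sub_one (modeRate θ)
  rw [cosh_modeRate] at h1
  have h2 : 1 - θ ^ 2 / 2 ≤ cos θ := one_sub_sq_div_two_le_cos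
  have h3 : modeRate θ ^ 2 ≤ |θ| ^ 2 := by rw [sq_abs]; linarith
  exact (pow_le_pow_iff_left₀ (modeRate_nonneg θ) (abs_nonneg θ) two_ne_zero).1 h3


/-- The constant `c₀ = 2 / (π cosh(π/2)) > 0` of the lower bound `μ(θ) ≥ c₀ |θ|`. [folklore] -/
def modeRateConst : ℝ := 2 / (π * cosh (π / 2))

/-- `c₀ > 0`. [folklore] -/
theorem modeRateConst_pos : 0 < modeRateConst := by
  unfold modeRateConst; positivity

/-- **Linear lower bound** `μ(θ) ≥ c₀ |θ|` for `|θ| ≤ π` (from `1 - cos θ ≥ (2/π²) θ²` and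
`cosh μ - 1 ≤ (μ²/2) cosh²(μ/2) ≤ (μ²/2) cosh²(π/2)`). [folklore] -/
theorem modeRateConst_mul_le {θ : ℝ} (hθ : |θ| ≤ π) : modeRateConst * |θ| ≤ modeRate θ := by
  set μ := modeRate θ with hμ
  have hμ0 : 0 ≤ μ := modeRate_nonneg θ
  have hμπ : μ ≤ π := (modeRate_le_abs θ).trans hθ
  have h1 : cosh μ - 1 ≤ μ ^ 2 / 2 * cosh (μ / 2) ^ 2 := cosh_sub_one_le_sq_mul_cosh_sq μ hμ0
  have h2 : cosh (μ / 2) ≤ cosh (π / 2) := by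
    rw [cosh_le_cosh, abs_of_nonneg (by linarith), abs_of_nonneg (by linarith [pi_pos])]
    linarith
  have h3 : cos θ ≤ 1 - 2 / π ^ 2 * θ ^ 2 := cos_le_one_sub_mul_cos_sq hθ
  rw [cosh_modeRate] at h1
  have h4 : 0 ≤ cosh (μ / 2) := (cosh_pos _).le
  have h5 : 2 / π ^ 2 * θ ^ 2 ≤ μ ^ 2 / 2 * cosh (π / 2) ^ 2 := by
    have := mul_le_mul h2 h2 h4 (h4.trans h2)
    nlinarith [sq_nonneg μ]
  -- `(2|θ|/π)² ≤ (μ cosh(π/2))²`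
  have hc : 0 < cosh (π / 2) := cosh_pos _
  have h6 : (2 * |θ| / π) ^ 2 ≤ (μ * cosh (π / 2)) ^ 2 := by
    rw [div_pow, mul_pow, sq_abs, mul_pow]
    rw [div_le_iff₀ (by positivity)]
    have : 2 / π ^ 2 * θ ^ 2 * π ^ 2 = 2 * θ ^ 2 := by field_simp
    nlinarith [h5, pi_pos]
  have h7 : 2 * |θ| / π ≤ μ * cosh (π / 2) :=
    (pow_le_pow_iff_left₀ (by positivity) (by positivity) two_ne_zero).1 h6
  unfold modeRateConst
  rw [div_mul_eq_mul_div, div_le_iff₀ (by positivity)]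
  calc 2 * |θ| = 2 * |θ| / π * π := by field_simp
    _ ≤ μ * cosh (π / 2) * π := by nlinarith [pi_pos]
    _ = μ * (π * cosh (π / 2)) := by ring

/-! ### Separable lattice-harmonic functions -/

/-- The lattice Laplacian in coordinates. [folklore] -/
theorem latticeLaplacian_coord (f : ℤ → ℤ → ℝ) (x : Site 2) :
    latticeLaplacian (fun y => f (y 0) (y 1)) x =
      f (x 0 + 1) (x 1) + f (x 0) (x 1 + 1) + f (x 0 - 1) (x 1) + f (x 0) (x 1 - 1) - 4 * f (x 0) (x 1) := by
  rw [latticeLaplacian_eq, Fin.sum_univ_four]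
  simp [cornerUnit, sub_eq_add_neg]

/-- **Separation of variables.** If `a (i+1) + a (i-1) = c a i`, `b (j+1) + b (j-1) = d b j` and
`c + d = 4`, then `(x₀, x₁) ↦ a x₀ · b x₁` is lattice-harmonic on all of `ℤ²`. [folklore] -/
theorem latticeLaplacian_mul_eq_zero {a b : ℤ → ℝ} {c d : ℝ} (ha : ∀ i, a (i + 1) + a (i - 1) = c * a i)
    (hb : ∀ j, b (j + 1) + b (j - 1) = d * b j) (hcd : c + d = 4) (x : Site 2) :
    latticeLaplacian (fun y => a (y 0) * b (y 1)) x = 0 := by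
  rw [latticeLaplacian_coord (fun i j => a i * b j)]
  linear_combination (b (x 1)) * ha (x 0) + (a (x 0)) * hb (x 1) + (a (x 0) * b (x 1)) * hcd

/-- Separation of variables, transposed: `(x₀, x₁) ↦ a x₁ · b x₀`. [folklore] -/
theorem latticeLaplacian_mul_eq_zero' {a b : ℤ → ℝ} {c d : ℝ} (ha : ∀ i, a (i + 1) + a (i - 1) = c * a i)
    (hb : ∀ j, b (j + 1) + b (j - 1) = d * b j) (hcd : c + d = 4) (x : Site 2) :
    latticeLaplacian (fun y => a (y 1) * b (y 0)) x = 0 := by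
  rw [latticeLaplacian_coord (fun i j => a j * b i)]
  linear_combination (b (x 0)) * ha (x 1) + (a (x 1)) * hb (x 0) + (a (x 1) * b (x 0)) * hcd

/-- `sin(θ(i+1)) + sin(θ(i-1)) = 2 cos θ · sin(θ i)`. [folklore] -/
theorem sin_recurrence (θ : ℝ) (i : ℤ) :
    sin (θ * ((i + 1 : ℤ) : ℝ)) + sin (θ * ((i - 1 : ℤ) : ℝ)) = 2 * cos θ * sin (θ * i) := by
  push_cast
  rw [mul_add, mul_sub, mul_one, sin_add, sin_sub]
  ring

/-- `sinh(μ(j+1)) + sinh(μ(j-1)) = 2 cosh μ · sinh(μ j)`. [folklore] -/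
theorem sinh_recurrence (μ : ℝ) (j : ℤ) :
    sinh (μ * ((j + 1 : ℤ) : ℝ)) + sinh (μ * ((j - 1 : ℤ) : ℝ)) = 2 * cosh μ * sinh (μ * j) := by
  push_cast
  rw [mul_add, mul_sub, mul_one, sinh_add, sinh_sub]
  ring

/-- The reflected version: `j ↦ sinh(μ (L - j))` satisfies the same recurrence. [folklore] -/
theorem sinh_recurrence' (μ L : ℝ) (j : ℤ) :
    sinh (μ * (L - ((j + 1 : ℤ) : ℝ))) + sinh (μ * (L - ((j - 1 : ℤ) : ℝ))) = 2 * cosh μ * sinh (μ * (L - j)) := by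
  push_cast
  rw [show μ * (L - (j + 1)) = μ * (L - j) - μ by ring, show μ * (L - (j - 1)) = μ * (L - j) + μ by ring,
    sinh_add, sinh_sub]
  ring

/-- `2 cos θ + 2 cosh μ(θ) = 4`. [folklore] -/
theorem two_mul_cos_add_two_mul_cosh_modeRate (θ : ℝ) : 2 * cos θ + 2 * cosh (modeRate θ) = 4 := by
  rw [cosh_modeRate]; ring

/-- The Laplacian of a finite sum. [folklore] -/
theorem latticeLaplacian_finset_sum {ι : Type*} (s : Finset ι) (g : ι → Site 2 → ℝ) (x : Site 2) :
    latticeLaplacian (fun y => ∑ k ∈ s, g k y) x = ∑ k ∈ s, latticeLaplacian (g k) x := by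
  simp only [latticeLaplacian, ← Finset.sum_sub_distrib]
  rw [Finset.sum_comm]

/-! ### The Poisson extension of data on the top side of a box -/

/-- The frequencies `θ_k = π k / N` of the box of side `N`. [folklore] -/
def boxFreq (N k : ℕ) : ℝ := π * k / N

/-- The vertical profile `r_k(j) = sinh(μ_k j) / sinh(μ_k N)` of the `k`-th mode (`= 1` at `j = N`,
`= 0` at `j = 0`). [folklore] -/
def sinhRatio (N k : ℕ) (j : ℤ) : ℝ :=
  sinh (modeRate (boxFreq N k) * j) / sinh (modeRate (boxFreq N k) * N)

/-- The discrete sine coefficients `c_k = (2/N) ∑_{i<N} φ(i) sin(θ_k i)` of data `φ` on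
`{1, …, N-1}`. [folklore] -/
def dstCoeff (N : ℕ) (φ : ℤ → ℝ) (k : ℕ) : ℝ := 2 / N * ∑ i ∈ range N, φ i * sin (boxFreq N k * i)

/-- **The Poisson extension of top-side data** on the box `[0, N]²`:
`u(x) = ∑_{k<N} c_k sin(θ_k x₀) sinh(μ_k x₁)/sinh(μ_k N)`, lattice-harmonic on all of `ℤ²`, equal to
`φ` on the open top side `{1 ≤ x₀ ≤ N-1, x₁ = N}` and to `0` on the three other sides.
[folklore] -/
def topExtension (N : ℕ) (φ : ℤ → ℝ) (x : Site 2) : ℝ :=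
  ∑ k ∈ range N, dstCoeff N φ k * (sin (boxFreq N k * x 0) * sinhRatio N k (x 1))

/-- The Poisson extension is lattice-harmonic everywhere. [folklore] -/
theorem latticeLaplacian_topExtension (N : ℕ) (φ : ℤ → ℝ) (x : Site 2) :
    latticeLaplacian (topExtension N φ) x = 0 := by
  unfold topExtension
  rw [latticeLaplacian_finset_sum]
  refine Finset.sum_eq_zero fun k _ => ?_
  rw [latticeLaplacian_const_mul]
  have := latticeLaplacian_mul_eq_zero (a := fun i : ℤ => sin (boxFreq N k * i))
    (b := fun j : ℤ => sinhRatio N k j) (c := 2 * cos (boxFreq N k)) (d := 2 * cosh (modeRate (boxFreq N k)))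
    (fun i => sin_recurrence _ i) (fun j => ?_) (two_mul_cos_add_two_mul_cosh_modeRate _) x
  · rw [this, mul_zero]
  · simp only [sinhRatio]
    rw [← add_div, sinh_recurrence, mul_div_assoc]

/-- `topExtension` vanishes on the left side `x₀ = 0`. [folklore] -/
theorem topExtension_left {N : ℕ} (φ : ℤ → ℝ) {x : Site 2} (hx : x 0 = 0) : topExtension N φ x = 0 := by
  unfold topExtension
  refine Finset.sum_eq_zero fun k _ => ?_
  simp [hx]

/-- `topExtension` vanishes on the bottom side `x₁ = 0`. [folklore] -/
theorem topExtension_bottom {N : ℕ} (φ : ℤ → ℝ) {x : Site 2} (hx : x 1 = 0) : topExtension N φ x = 0 := by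
  unfold topExtension
  refine Finset.sum_eq_zero fun k _ => ?_
  simp [hx, sinhRatio]

/-- `topExtension` vanishes on the right side `x₀ = N`. [folklore] -/
theorem topExtension_right {N : ℕ} (φ : ℤ → ℝ) {x : Site 2} (hx : x 0 = N) : topExtension N φ x = 0 := by
  unfold topExtension
  refine Finset.sum_eq_zero fun k _ => ?_
  rcases Nat.eq_zero_or_pos N with rfl | hN
  · simp at *
  · have : boxFreq N k * x 0 = k * π := by
      rw [hx, boxFreq]; push_cast; field_simp
    rw [this, sin_nat_mul_pi]; simp


/-- For `1 ≤ k ≤ N` the mode rate `μ_k = μ(πk/N)` is positive (`cos(πk/N) < 1`). [folklore] -/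
theorem modeRate_boxFreq_pos {N k : ℕ} (hk : 0 < k) (hkN : k ≤ N) : 0 < modeRate (boxFreq N k) := by
  apply arcosh_pos
  have hN : (0 : ℝ) < N := by exact_mod_cast (hk.trans_le hkN)
  have h1 : 0 < boxFreq N k := by unfold boxFreq; positivity
  have h2 : boxFreq N k ≤ π := by
    unfold boxFreq
    rw [div_le_iff₀ hN]
    have : (k : ℝ) ≤ N := by exact_mod_cast hkN
    nlinarith [pi_pos]
  have h3 : cos (boxFreq N k) ≠ 1 := by
    rw [Ne, cos_eq_one_iff_of_lt_of_lt (by linarith [pi_pos]) (by linarith [pi_pos])]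
    exact h1.ne'
  have h4 := cos_le_one (boxFreq N k)
  have : cos (boxFreq N k) < 1 := lt_of_le_of_ne h4 h3
  linarith

/-- `sinh(μ_k N) > 0` for `1 ≤ k ≤ N`. [folklore] -/
theorem sinh_modeRate_mul_pos {N k : ℕ} (hk : 0 < k) (hkN : k ≤ N) :
    0 < sinh (modeRate (boxFreq N k) * N) := by
  rw [sinh_pos_iff]
  have hN : (0 : ℝ) < N := by exact_mod_cast (hk.trans_le hkN)
  exact mul_pos (modeRate_boxFreq_pos hk hkN) hN

/-- `r_k(N) = 1` for `1 ≤ k ≤ N`. [folklore] -/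
theorem sinhRatio_self {N k : ℕ} (hk : 0 < k) (hkN : k ≤ N) : sinhRatio N k N = 1 := by
  unfold sinhRatio
  exact div_self (sinh_modeRate_mul_pos hk hkN).ne'

/-- **Top boundary values**: on the open top side, `topExtension N φ (i, N) = φ i`
(`1 ≤ i ≤ N - 1`), by the orthogonality of the discrete sine transform. [folklore] -/
theorem topExtension_top {N : ℕ} (φ : ℤ → ℝ) {i : ℕ} (hi : 0 < i) (hiN : i < N) {x : Site 2}
    (hx0 : x 0 = i) (hx1 : x 1 = N) : topExtension N φ x = φ i := by
  unfold topExtension dstCoeff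
  have hN : 0 < N := by omega
  have hNr : (N : ℝ) ≠ 0 := by exact_mod_cast hN.ne'
  have step1 : ∀ k ∈ range N,
      (2 / N * ∑ i' ∈ range N, φ i' * sin (boxFreq N k * (i' : ℕ))) * (sin (boxFreq N k * x 0) * sinhRatio N k (x 1))
        = 2 / N * ∑ i' ∈ range N, φ i' * (sin (π * (i' : ℕ) * k / N) * sin (π * i * k / N)) := by
    intro k hk
    rw [hx0, hx1]
    rcases Nat.eq_zero_or_pos k with rfl | hk0
    · simp [boxFreq]
    · rw [sinhRatio_self hk0 (mem_range.1 hk).le, mul_one, mul_assoc, Finset.sum_mul]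
      congr 1
      refine Finset.sum_congr rfl fun i' _ => ?_
      simp only [boxFreq, Int.cast_natCast]
      ring_nf
  rw [Finset.sum_congr rfl step1, ← Finset.mul_sum, Finset.sum_comm]
  simp_rw [← Finset.mul_sum]
  rw [Finset.sum_eq_single i]
  · rw [sum_sin_mul_sin hi hiN hi hiN, if_pos rfl]
    field_simp
  · intro i' hi' hne
    rcases Nat.eq_zero_or_pos i' with rfl | hi'0
    · simp
    · rw [sum_sin_mul_sin hi'0 (mem_range.1 hi') hi hiN, if_neg hne, mul_zero]
  · intro h; exact absurd (mem_range.2 hiN) h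


/-! ### Elementary exponential bounds -/

/-- `sinh(μ j) ≤ e^{-μ(L-j)} sinh(μ L)` for `0 ≤ μ`, `j ≤ L`. [folklore] -/
theorem sinh_le_exp_neg_mul_sinh {μ j L : ℝ} (hμ : 0 ≤ μ) (hjL : j ≤ L) :
    sinh (μ * j) ≤ exp (-(μ * (L - j))) * sinh (μ * L) := by
  rw [sinh_eq, sinh_eq]
  have h1 : exp (-(μ * (L - j))) * ((exp (μ * L) - exp (-(μ * L))) / 2)
      = (exp (μ * j) - exp (-(μ * (2 * L - j)))) / 2 := by
    rw [mul_div_assoc', mul_sub, ← exp_add, ← exp_add]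
    congr 2 <;> ring_nf
  rw [h1]
  have h2 : exp (-(μ * (2 * L - j))) ≤ exp (-(μ * j)) := by
    rw [exp_le_exp]
    nlinarith
  linarith

/-- `e^x - 1 ≤ x e^x`. [folklore] -/
private theorem exp_sub_one_le_mul_exp (x : ℝ) : exp x - 1 ≤ x * exp x := by
  have h := add_one_le_exp (-x)
  have hx' : 0 < exp x := exp_pos x
  have : exp (-x) * exp x = 1 := by rw [← exp_add]; simp
  nlinarith

/-- `sinh(μ(j+1)) - sinh(μ j) ≤ μ e^{μ (j+1)}` for `μ, j ≥ 0`. [folklore] -/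
theorem sinh_succ_sub_sinh_le {μ j : ℝ} (hμ : 0 ≤ μ) (hj : 0 ≤ j) :
    sinh (μ * (j + 1)) - sinh (μ * j) ≤ μ * exp (μ * (j + 1)) := by
  rw [sinh_eq, sinh_eq, mul_add, mul_one, exp_add]
  set A := exp (μ * j) with hA
  set B := exp μ with hB
  set y := exp (-(μ * j)) with hy
  set z := exp (-(μ * j + μ)) with hz
  have h1 : B - 1 ≤ μ * B := exp_sub_one_le_mul_exp μ
  have hA1 : 1 ≤ A := by rw [hA]; exact one_le_exp (by positivity)
  have hB1 : 1 ≤ B := by rw [hB]; exact one_le_exp hμ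
  have hy1 : y ≤ 1 := by rw [hy, exp_le_one_iff]; nlinarith
  have hz0 : 0 ≤ z := (exp_pos _).le
  have hzB : z * B = y := by rw [hz, hB, hy, ← exp_add]; ring_nf
  -- `y - z = z (B - 1) ≤ z μ B = μ y ≤ μ ≤ μ A B`
  have h2 : y - z ≤ μ * (A * B) := by
    have : y - z = z * (B - 1) := by rw [← hzB]; ring
    rw [this]
    calc z * (B - 1) ≤ z * (μ * B) := mul_le_mul_of_nonneg_left h1 hz0
      _ = μ * y := by rw [← hzB]; ring
      _ ≤ μ * 1 := mul_le_mul_of_nonneg_left hy1 hμ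
      _ ≤ μ * (A * B) := mul_le_mul_of_nonneg_left (by nlinarith) hμ
  have h3 : A * B - A ≤ μ * (A * B) := by
    have : A * B - A = A * (B - 1) := by ring
    rw [this]
    calc A * (B - 1) ≤ A * (μ * B) := mul_le_mul_of_nonneg_left h1 (by linarith)
      _ = μ * (A * B) := by ring
  linarith

/-- `0 ≤ sinh(μ(j+1)) - sinh(μ j)` for `μ ≥ 0`. [folklore] -/
theorem sinh_mono_step {μ j : ℝ} (hμ : 0 ≤ μ) : sinh (μ * j) ≤ sinh (μ * (j + 1)) := by
  rw [sinh_le_sinh]; nlinarith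

/-- `sinh x ≥ (1 - e^{-2m})/2 · e^x` for `x ≥ m`. [folklore] -/
theorem sinh_ge_of_le {m x : ℝ} (hmx : m ≤ x) : (1 - exp (-(2 * m))) / 2 * exp x ≤ sinh x := by
  rw [sinh_eq]
  have h1 : exp (-x) = exp (-(2 * x)) * exp x := by rw [← exp_add]; ring_nf
  have h2 : exp (-(2 * x)) ≤ exp (-(2 * m)) := by rw [exp_le_exp]; linarith
  have h3 : 0 < exp x := exp_pos x
  nlinarith

/-- `k e^{-a k} ≤ (2/a) e^{-a k/2}` for `a > 0`, `k ≥ 0`. [folklore] -/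
theorem mul_exp_neg_le {a : ℝ} (k : ℝ) (ha : 0 < a) :
    k * exp (-(a * k)) ≤ 2 / a * exp (-(a * k / 2)) := by
  have h1 : a * k / 2 ≤ exp (a * k / 2) := by
    have := add_one_le_exp (a * k / 2); linarith
  have h2 : exp (-(a * k)) = exp (-(a * k / 2)) * exp (-(a * k / 2)) := by rw [← exp_add]; ring_nf
  have h3 : 0 < exp (-(a * k / 2)) := exp_pos _
  have h4 : k = 2 / a * (a * k / 2) := by field_simp
  calc k * exp (-(a * k)) = 2 / a * (a * k / 2) * (exp (-(a * k / 2)) * exp (-(a * k / 2))) := by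
        rw [← h4, h2]
    _ ≤ 2 / a * exp (a * k / 2) * (exp (-(a * k / 2)) * exp (-(a * k / 2))) := by
        gcongr
    _ = 2 / a * exp (-(a * k / 2)) := by
        have : exp (a * k / 2) * exp (-(a * k / 2)) = 1 := by rw [← exp_add]; simp
        calc 2 / a * exp (a * k / 2) * (exp (-(a * k / 2)) * exp (-(a * k / 2)))
            = 2 / a * (exp (a * k / 2) * exp (-(a * k / 2))) * exp (-(a * k / 2)) := by ring
          _ = 2 / a * exp (-(a * k / 2)) := by rw [this, mul_one]

/-- Finite geometric sums: `∑_{k<N} e^{-a k} ≤ 1/(1 - e^{-a})` for `a > 0`. [folklore] -/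
theorem sum_exp_neg_mul_le {a : ℝ} (ha : 0 < a) (N : ℕ) :
    ∑ k ∈ range N, exp (-(a * k)) ≤ 1 / (1 - exp (-a)) := by
  have hr0 : 0 ≤ exp (-a) := (exp_pos _).le
  have hr1 : exp (-a) < 1 := by rw [exp_lt_one_iff]; linarith
  have h1 : ∀ k ∈ range N, exp (-(a * k)) = exp (-a) ^ k := fun k _ => by
    rw [← exp_nat_mul]; ring_nf
  rw [Finset.sum_congr rfl h1, geom_sum_eq hr1.ne]
  have h2 : (exp (-a) ^ N - 1) / (exp (-a) - 1) = (1 - exp (-a) ^ N) / (1 - exp (-a)) := by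
    rw [← neg_sub 1 (exp (-a) ^ N), ← neg_sub 1 (exp (-a)), neg_div_neg_eq]
  rw [h2]
  exact div_le_div_of_nonneg_right (by linarith [pow_nonneg hr0 N]) (by linarith)

/-- `∑_{k<N} k e^{-a k} ≤ (2/a)/(1 - e^{-a/2})` for `a > 0`. [folklore] -/
theorem sum_mul_exp_neg_mul_le {a : ℝ} (ha : 0 < a) (N : ℕ) :
    ∑ k ∈ range N, (k : ℝ) * exp (-(a * k)) ≤ 2 / a / (1 - exp (-(a / 2))) := by
  calc ∑ k ∈ range N, (k : ℝ) * exp (-(a * k)) ≤ ∑ k ∈ range N, 2 / a * exp (-(a / 2 * k)) :=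
        Finset.sum_le_sum fun k _ => by
          have := mul_exp_neg_le (k : ℝ) ha
          rwa [show a * k / 2 = a / 2 * k by ring] at this
    _ = 2 / a * ∑ k ∈ range N, exp (-(a / 2 * k)) := by rw [Finset.mul_sum]
    _ ≤ 2 / a * (1 / (1 - exp (-(a / 2)))) := by
        gcongr
        exact sum_exp_neg_mul_le (by linarith) N
    _ = 2 / a / (1 - exp (-(a / 2))) := by ring


/-! ### Estimates for the modes -/

/-- The decay rate `a = c₀ π / 8` of the modes seen from the lower seven eighths of the box. [folklore] -/
def decayRate : ℝ := modeRateConst * π / 8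

/-- `a > 0`. [folklore] -/
theorem decayRate_pos : 0 < decayRate := by
  unfold decayRate; have := modeRateConst_pos; positivity

/-- The constant `c₁ = (1 - e^{-2 c₀ π})/2` with `sinh(μ_k N) ≥ c₁ e^{μ_k N}` for `k ≥ 1`. [folklore] -/
def sinhLower : ℝ := (1 - exp (-(2 * (modeRateConst * π)))) / 2

/-- `c₁ > 0`. [folklore] -/
theorem sinhLower_pos : 0 < sinhLower := by
  unfold sinhLower
  have : exp (-(2 * (modeRateConst * π))) < 1 := by
    rw [exp_lt_one_iff]; have := modeRateConst_pos; have := pi_pos; nlinarith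
  linarith

/-- `θ_k ≥ 0`. [folklore] -/
theorem boxFreq_nonneg (N k : ℕ) : 0 ≤ boxFreq N k := by unfold boxFreq; positivity

/-- `θ_k ≤ π` for `k ≤ N`. [folklore] -/
theorem boxFreq_le_pi {N k : ℕ} (hkN : k ≤ N) : boxFreq N k ≤ π := by
  unfold boxFreq
  rcases Nat.eq_zero_or_pos N with rfl | hN
  · simp; exact pi_pos.le
  · have hNr : (0 : ℝ) < N := by exact_mod_cast hN
    rw [div_le_iff₀ hNr]
    have : (k : ℝ) ≤ N := by exact_mod_cast hkN
    nlinarith [pi_pos]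

/-- `μ_k ≥ c₀ θ_k`. [folklore] -/
theorem modeRateConst_mul_boxFreq_le {N k : ℕ} (hkN : k ≤ N) :
    modeRateConst * boxFreq N k ≤ modeRate (boxFreq N k) := by
  have h := modeRateConst_mul_le (θ := boxFreq N k)
    (by rw [abs_of_nonneg (boxFreq_nonneg N k)]; exact boxFreq_le_pi hkN)
  rwa [abs_of_nonneg (boxFreq_nonneg N k)] at h

/-- `μ_k ≤ θ_k`. [folklore] -/
theorem modeRate_boxFreq_le (N k : ℕ) : modeRate (boxFreq N k) ≤ boxFreq N k := by
  have := modeRate_le_abs (boxFreq N k)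
  rwa [abs_of_nonneg (boxFreq_nonneg N k)] at this

/-- `μ_k (N - j) ≥ a k` when `8 j ≤ 7 N`. [folklore] -/
theorem decayRate_mul_le {N k : ℕ} {t : ℝ} (hkN : k ≤ N) (hN : 0 < N) (h8 : 8 * t ≤ 7 * N) :
    decayRate * k ≤ modeRate (boxFreq N k) * (N - t) := by
  have hNr : (0 : ℝ) < N := by exact_mod_cast hN
  have h1 := modeRateConst_mul_boxFreq_le hkN
  have h2 : (N : ℝ) / 8 ≤ N - t := by linarith
  have h3 : 0 ≤ modeRateConst * boxFreq N k := mul_nonneg modeRateConst_pos.le (boxFreq_nonneg N k)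
  calc decayRate * k = modeRateConst * boxFreq N k * (N / 8) := by
        unfold decayRate boxFreq; field_simp
    _ ≤ modeRate (boxFreq N k) * (N - t) :=
        mul_le_mul h1 h2 (by positivity) (modeRate_nonneg _)

/-- `r_k(j) ≥ 0` for `j ≥ 0`. [folklore] -/
theorem sinhRatio_nonneg (N k : ℕ) {j : ℤ} (hj : 0 ≤ j) : 0 ≤ sinhRatio N k j :=
  div_nonneg (sinh_nonneg_iff.2 (mul_nonneg (modeRate_nonneg _) (by exact_mod_cast hj)))
    (sinh_nonneg_iff.2 (mul_nonneg (modeRate_nonneg _) (Nat.cast_nonneg N)))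

/-- `r_k(j) ≤ e^{-μ_k (N - j)}` for `0 ≤ j ≤ N`. [folklore] -/
theorem sinhRatio_le_exp (N k : ℕ) {j : ℤ} (hjN : j ≤ N) :
    sinhRatio N k j ≤ exp (-(modeRate (boxFreq N k) * (N - j))) := by
  unfold sinhRatio
  set μ := modeRate (boxFreq N k)
  have hμ : 0 ≤ μ := modeRate_nonneg _
  have h1 := sinh_le_exp_neg_mul_sinh (μ := μ) (j := (j : ℝ)) (L := (N : ℝ)) hμ (by exact_mod_cast hjN)
  rcases (sinh_nonneg_iff.2 (mul_nonneg hμ (Nat.cast_nonneg N))).eq_or_lt with h0 | hpos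
  · rw [← h0, div_zero]; exact (exp_pos _).le
  · rwa [div_le_iff₀ hpos]

/-- `r_k(j) ≤ e^{-a k}` when `0 ≤ j`, `8 j ≤ 7 N`, `k ≤ N`. [folklore] -/
theorem sinhRatio_le_exp_decay {N k : ℕ} {j : ℤ} (hkN : k ≤ N) (h8 : 8 * j ≤ 7 * (N : ℤ)) :
    sinhRatio N k j ≤ exp (-(decayRate * k)) := by
  rcases Nat.eq_zero_or_pos N with rfl | hN
  · have hk : k = 0 := by omega
    subst hk
    simp [sinhRatio]
  have hjN : j ≤ N := by
    have : (8 : ℤ) * j ≤ 8 * N := by linarith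
    linarith
  refine (sinhRatio_le_exp N k hjN).trans ?_
  rw [exp_le_exp, neg_le_neg_iff]
  exact decayRate_mul_le hkN hN (by exact_mod_cast h8)

/-- `sinh(μ_k N) ≥ c₁ e^{μ_k N}` for `1 ≤ k ≤ N`. [folklore] -/
theorem sinhLower_mul_exp_le {N k : ℕ} (hk : 0 < k) (hkN : k ≤ N) :
    sinhLower * exp (modeRate (boxFreq N k) * N) ≤ sinh (modeRate (boxFreq N k) * N) := by
  apply sinh_ge_of_le
  -- `c₀ π ≤ c₀ θ_k N ≤ μ_k N`
  have hN : 0 < N := hk.trans_le hkN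
  have hNr : (0 : ℝ) < N := by exact_mod_cast hN
  have h1 := modeRateConst_mul_boxFreq_le hkN
  have h2 : modeRateConst * π ≤ modeRateConst * boxFreq N k * N := by
    unfold boxFreq
    rw [show modeRateConst * (π * k / N) * N = modeRateConst * π * k by field_simp]
    have hk1 : (1 : ℝ) ≤ k := by exact_mod_cast hk
    have hc : 0 < modeRateConst * π := mul_pos modeRateConst_pos pi_pos
    nlinarith
  calc modeRateConst * π ≤ modeRateConst * boxFreq N k * N := h2
    _ ≤ modeRate (boxFreq N k) * N := mul_le_mul_of_nonneg_right h1 hNr.le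

/-- `r_k(j) ≤ r_k(j+1)`. [folklore] -/
theorem sinhRatio_le_succ (N k : ℕ) (j : ℤ) : sinhRatio N k j ≤ sinhRatio N k (j + 1) := by
  unfold sinhRatio
  refine div_le_div_of_nonneg_right ?_ (sinh_nonneg_iff.2 (mul_nonneg (modeRate_nonneg _) (Nat.cast_nonneg N)))
  push_cast
  exact sinh_mono_step (modeRate_nonneg _)

/-- **Vertical increments of the modes**: `r_k(j+1) - r_k(j) ≤ (θ_k / c₁) e^{-a k}` for `1 ≤ k ≤ N`,
`0 ≤ j`, `8 (j+1) ≤ 7 N`. [folklore] -/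
theorem sinhRatio_succ_sub_le {N k : ℕ} {j : ℤ} (hk : 0 < k) (hkN : k ≤ N) (hj : 0 ≤ j)
    (h8 : 8 * (j + 1) ≤ 7 * (N : ℤ)) :
    sinhRatio N k (j + 1) - sinhRatio N k j ≤ boxFreq N k / sinhLower * exp (-(decayRate * k)) := by
  have hN : 0 < N := hk.trans_le hkN
  set μ := modeRate (boxFreq N k) with hμdef
  have hμ : 0 ≤ μ := modeRate_nonneg _
  have hden : 0 < sinh (μ * N) := sinh_modeRate_mul_pos hk hkN
  unfold sinhRatio
  rw [← hμdef, ← sub_div, div_le_iff₀ hden]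
  push_cast
  have h1 : sinh (μ * (j + 1)) - sinh (μ * j) ≤ μ * exp (μ * (j + 1)) :=
    sinh_succ_sub_sinh_le hμ (by exact_mod_cast hj)
  have h2 := sinhLower_mul_exp_le hk hkN
  rw [← hμdef] at h2
  have h3 : μ ≤ boxFreq N k := modeRate_boxFreq_le N k
  have h4 : decayRate * k ≤ μ * (N - (j + 1)) := decayRate_mul_le hkN hN (by exact_mod_cast h8)
  -- `μ e^{μ(j+1)} ≤ θ_k e^{-a k} e^{μ N} ≤ (θ_k / c₁) e^{-ak} sinh(μ N)`
  have hsl := sinhLower_pos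
  calc sinh (μ * (j + 1)) - sinh (μ * j) ≤ μ * exp (μ * (j + 1)) := h1
    _ ≤ boxFreq N k * (exp (-(decayRate * k)) * exp (μ * N)) := by
        refine mul_le_mul h3 ?_ (exp_pos _).le (boxFreq_nonneg N k)
        rw [← exp_add, exp_le_exp]
        linarith
    _ = boxFreq N k / sinhLower * exp (-(decayRate * k)) * (sinhLower * exp (μ * N)) := by
        field_simp
    _ ≤ boxFreq N k / sinhLower * exp (-(decayRate * k)) * sinh (μ * N) := by
        refine mul_le_mul_of_nonneg_left h2 ?_
        exact mul_nonneg (div_nonneg (boxFreq_nonneg N k) hsl.le) (exp_pos _).le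


/-! ### Estimates for the Poisson extension of top-side data -/

/-- `|c_k| ≤ (2/N) ∑_{1 ≤ i < N} |φ i|` (the `i = 0` term of the sine transform vanishes, so the
corner value `φ 0` does not enter). [folklore] -/
theorem abs_dstCoeff_le (N : ℕ) (φ : ℤ → ℝ) (k : ℕ) :
    |dstCoeff N φ k| ≤ 2 / N * ∑ i ∈ Ico 1 N, |φ i| := by
  unfold dstCoeff
  rw [abs_mul, abs_of_nonneg (by positivity : (0:ℝ) ≤ 2 / N)]
  refine mul_le_mul_of_nonneg_left ?_ (by positivity)
  rcases Nat.eq_zero_or_pos N with rfl | hN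
  · simp
  rw [Finset.range_eq_Ico, Finset.sum_eq_sum_Ico_succ_bot hN]
  simp only [Nat.cast_zero, mul_zero, sin_zero, zero_add]
  refine (abs_sum_le_sum_abs _ _).trans (Finset.sum_le_sum fun i _ => ?_)
  rw [abs_mul]
  exact mul_le_of_le_one_right (abs_nonneg _) (abs_sin_le_one _)

/-- The geometric constant `1/(1 - e^{-a})` bounding `∑_k e^{-a k}`. [folklore] -/
def geomConst : ℝ := 1 / (1 - exp (-decayRate))

/-- The constant `(2/a)/(1 - e^{-a/2})` bounding `∑_k k e^{-a k}`. [folklore] -/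
def linGeomConst : ℝ := 2 / decayRate / (1 - exp (-(decayRate / 2)))

/-- `C_g > 0`. [folklore] -/
theorem geomConst_pos : 0 < geomConst := by
  unfold geomConst
  have : exp (-decayRate) < 1 := by rw [exp_lt_one_iff]; linarith [decayRate_pos]
  exact div_pos one_pos (by linarith)

/-- `C_ℓ > 0`. [folklore] -/
theorem linGeomConst_pos : 0 < linGeomConst := by
  unfold linGeomConst
  have : exp (-(decayRate / 2)) < 1 := by rw [exp_lt_one_iff]; linarith [decayRate_pos]
  exact div_pos (div_pos two_pos decayRate_pos) (by linarith)

/-- **Sup bound**: `|u(x)| ≤ (2 C_g / N) ∑ |φ|` on the lower seven eighths `0 ≤ x₁ ≤ 7N/8`.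
[folklore] -/
theorem abs_topExtension_le {N : ℕ} (φ : ℤ → ℝ) {x : Site 2} (hx : 0 ≤ x 1) (h8 : 8 * x 1 ≤ 7 * (N : ℤ)) :
    |topExtension N φ x| ≤ 2 * geomConst / N * ∑ i ∈ Ico 1 N, |φ i| := by
  have hT0 : 0 ≤ ∑ i ∈ Ico 1 N, |φ i| := Finset.sum_nonneg fun i _ => abs_nonneg _
  have hck : ∀ k, |dstCoeff N φ k| ≤ 2 / N * ∑ i ∈ Ico 1 N, |φ i| := abs_dstCoeff_le N φ
  generalize ∑ i ∈ Ico 1 N, |φ i| = T at hT0 hck ⊢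
  unfold topExtension
  calc |∑ k ∈ range N, dstCoeff N φ k * (sin (boxFreq N k * x 0) * sinhRatio N k (x 1))|
      ≤ ∑ k ∈ range N, |dstCoeff N φ k * (sin (boxFreq N k * x 0) * sinhRatio N k (x 1))| :=
        abs_sum_le_sum_abs _ _
    _ ≤ ∑ k ∈ range N, 2 / N * T * exp (-(decayRate * k)) := by
        refine Finset.sum_le_sum fun k hk => ?_
        have hkN : k ≤ N := (mem_range.1 hk).le
        rw [abs_mul, abs_mul, abs_of_nonneg (sinhRatio_nonneg N k hx)]
        refine mul_le_mul (hck k) ?_ (mul_nonneg (abs_nonneg _) (sinhRatio_nonneg N k hx)) (by positivity)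
        calc |sin (boxFreq N k * x 0)| * sinhRatio N k (x 1) ≤ 1 * sinhRatio N k (x 1) :=
              mul_le_mul_of_nonneg_right (abs_sin_le_one _) (sinhRatio_nonneg N k hx)
          _ ≤ exp (-(decayRate * k)) := by rw [one_mul]; exact sinhRatio_le_exp_decay hkN h8
    _ = 2 / N * T * ∑ k ∈ range N, exp (-(decayRate * k)) := by rw [Finset.mul_sum]
    _ ≤ 2 / N * T * geomConst := by
        refine mul_le_mul_of_nonneg_left ?_ (by positivity)
        exact sum_exp_neg_mul_le decayRate_pos N
    _ = 2 * geomConst / N * T := by ring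

/-- **Horizontal increments**: `|u(x + e₀) - u(x)| ≤ (2π C_ℓ / N²) ∑ |φ|` on `0 ≤ x₁ ≤ 7N/8`.
[folklore] -/
theorem abs_topExtension_add_cornerUnit_zero_sub_le {N : ℕ} (φ : ℤ → ℝ) {x : Site 2} (hx : 0 ≤ x 1)
    (h8 : 8 * x 1 ≤ 7 * (N : ℤ)) :
    |topExtension N φ (x + cornerUnit 0) - topExtension N φ x| ≤
      2 * π * linGeomConst / N ^ 2 * ∑ i ∈ Ico 1 N, |φ i| := by
  have hT0 : 0 ≤ ∑ i ∈ Ico 1 N, |φ i| := Finset.sum_nonneg fun i _ => abs_nonneg _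
  have hck : ∀ k, |dstCoeff N φ k| ≤ 2 / N * ∑ i ∈ Ico 1 N, |φ i| := abs_dstCoeff_le N φ
  generalize ∑ i ∈ Ico 1 N, |φ i| = T at hT0 hck ⊢
  unfold topExtension
  have hc0 : (x + cornerUnit 0) 0 = x 0 + 1 := by simp [cornerUnit]
  have hc1 : (x + cornerUnit 0) 1 = x 1 := by simp [cornerUnit]
  rw [hc0, hc1, ← Finset.sum_sub_distrib]
  calc |∑ k ∈ range N, (dstCoeff N φ k * (sin (boxFreq N k * ((x 0 + 1 : ℤ) : ℝ)) * sinhRatio N k (x 1)) -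
          dstCoeff N φ k * (sin (boxFreq N k * x 0) * sinhRatio N k (x 1)))|
      ≤ ∑ k ∈ range N, |dstCoeff N φ k * (sin (boxFreq N k * ((x 0 + 1 : ℤ) : ℝ)) * sinhRatio N k (x 1)) -
          dstCoeff N φ k * (sin (boxFreq N k * x 0) * sinhRatio N k (x 1))| := abs_sum_le_sum_abs _ _
    _ ≤ ∑ k ∈ range N, 2 / N * T * (π / N * (k * exp (-(decayRate * k)))) := by
        refine Finset.sum_le_sum fun k hk => ?_
        have hkN : k ≤ N := (mem_range.1 hk).le
        rw [← mul_sub, ← sub_mul, abs_mul, abs_mul, abs_of_nonneg (sinhRatio_nonneg N k hx)]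
        refine mul_le_mul (hck k) ?_ (mul_nonneg (abs_nonneg _) (sinhRatio_nonneg N k hx)) (by positivity)
        have h1 : |sin (boxFreq N k * ((x 0 + 1 : ℤ) : ℝ)) - sin (boxFreq N k * x 0)| ≤ boxFreq N k := by
          refine (abs_sin_sub_sin_le _ _).trans ?_
          push_cast
          rw [show boxFreq N k * (x 0 + 1) - boxFreq N k * x 0 = boxFreq N k by ring,
            abs_of_nonneg (boxFreq_nonneg N k)]
        calc |sin (boxFreq N k * ((x 0 + 1 : ℤ) : ℝ)) - sin (boxFreq N k * x 0)| * sinhRatio N k (x 1)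
            ≤ boxFreq N k * exp (-(decayRate * k)) :=
              mul_le_mul h1 (sinhRatio_le_exp_decay hkN h8) (sinhRatio_nonneg N k hx) (boxFreq_nonneg N k)
          _ = π / N * (k * exp (-(decayRate * k))) := by unfold boxFreq; ring
    _ = 2 / N * T * (π / N) * ∑ k ∈ range N, (k : ℝ) * exp (-(decayRate * k)) := by
        rw [Finset.mul_sum]; exact Finset.sum_congr rfl fun k _ => by ring
    _ ≤ 2 / N * T * (π / N) * linGeomConst := by
        refine mul_le_mul_of_nonneg_left ?_ (by positivity)
        exact sum_mul_exp_neg_mul_le decayRate_pos N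
    _ = 2 * π * linGeomConst / N ^ 2 * T := by ring

/-- **Vertical increments**: `|u(x + e₁) - u(x)| ≤ (2π C_ℓ /(c₁ N²)) ∑ |φ|` for `0 ≤ x₁`,
`8(x₁ + 1) ≤ 7N`. [folklore] -/
theorem abs_topExtension_add_cornerUnit_one_sub_le {N : ℕ} (φ : ℤ → ℝ) {x : Site 2} (hx : 0 ≤ x 1)
    (h8 : 8 * (x 1 + 1) ≤ 7 * (N : ℤ)) :
    |topExtension N φ (x + cornerUnit 1) - topExtension N φ x| ≤
      2 * π * linGeomConst / sinhLower / N ^ 2 * ∑ i ∈ Ico 1 N, |φ i| := by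
  have hT0 : 0 ≤ ∑ i ∈ Ico 1 N, |φ i| := Finset.sum_nonneg fun i _ => abs_nonneg _
  have hck : ∀ k, |dstCoeff N φ k| ≤ 2 / N * ∑ i ∈ Ico 1 N, |φ i| := abs_dstCoeff_le N φ
  generalize ∑ i ∈ Ico 1 N, |φ i| = T at hT0 hck ⊢
  unfold topExtension
  have hc0 : (x + cornerUnit 1) 0 = x 0 := by simp [cornerUnit]
  have hc1 : (x + cornerUnit 1) 1 = x 1 + 1 := by simp [cornerUnit]
  have hsl := sinhLower_pos
  rw [hc0, hc1, ← Finset.sum_sub_distrib]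
  calc |∑ k ∈ range N, (dstCoeff N φ k * (sin (boxFreq N k * x 0) * sinhRatio N k (x 1 + 1)) -
          dstCoeff N φ k * (sin (boxFreq N k * x 0) * sinhRatio N k (x 1)))|
      ≤ ∑ k ∈ range N, |dstCoeff N φ k * (sin (boxFreq N k * x 0) * sinhRatio N k (x 1 + 1)) -
          dstCoeff N φ k * (sin (boxFreq N k * x 0) * sinhRatio N k (x 1))| := abs_sum_le_sum_abs _ _
    _ ≤ ∑ k ∈ range N, 2 / N * T * (π / (sinhLower * N) * (k * exp (-(decayRate * k)))) := by
        refine Finset.sum_le_sum fun k hk => ?_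
        have hkN : k ≤ N := (mem_range.1 hk).le
        rw [← mul_sub, ← mul_sub, abs_mul, abs_mul]
        refine mul_le_mul (hck k) ?_ (by positivity) (by positivity)
        have hdiff0 : 0 ≤ sinhRatio N k (x 1 + 1) - sinhRatio N k (x 1) := by
          linarith [sinhRatio_le_succ N k (x 1)]
        rw [abs_of_nonneg hdiff0]
        rcases Nat.eq_zero_or_pos k with rfl | hk0
        · simp [boxFreq]
        · calc |sin (boxFreq N k * x 0)| * (sinhRatio N k (x 1 + 1) - sinhRatio N k (x 1))
              ≤ 1 * (boxFreq N k / sinhLower * exp (-(decayRate * k))) :=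
                mul_le_mul (abs_sin_le_one _) (sinhRatio_succ_sub_le hk0 hkN hx h8) hdiff0 zero_le_one
            _ = π / (sinhLower * N) * (k * exp (-(decayRate * k))) := by unfold boxFreq; field_simp
    _ = 2 / N * T * (π / (sinhLower * N)) * ∑ k ∈ range N, (k : ℝ) * exp (-(decayRate * k)) := by
        rw [Finset.mul_sum]; exact Finset.sum_congr rfl fun k _ => by ring
    _ ≤ 2 / N * T * (π / (sinhLower * N)) * linGeomConst := by
        refine mul_le_mul_of_nonneg_left ?_ (by positivity)
        exact sum_mul_exp_neg_mul_le decayRate_pos N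
    _ = 2 * π * linGeomConst / sinhLower / N ^ 2 * T := by
        field_simp

/-- `c₁ ≤ 1/2`. [folklore] -/
theorem sinhLower_le : sinhLower ≤ 1 / 2 := by
  unfold sinhLower; have := exp_pos (-(2 * (modeRateConst * π))); linarith

/-- The gradient constant `K = 2π C_ℓ / c₁` of the Poisson extension. [folklore] -/
def topGradConst : ℝ := 2 * π * linGeomConst / sinhLower

/-- `K > 0`. [folklore] -/
theorem topGradConst_pos : 0 < topGradConst := by
  unfold topGradConst
  exact div_pos (by have := linGeomConst_pos; positivity) sinhLower_pos

/-- The four elements of `Fin 4`. [folklore] -/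
private theorem fin4_cases (k : Fin 4) : k = 0 ∨ k = 1 ∨ k = 2 ∨ k = 3 := by
  revert k; decide

/-- **All four increments** of the Poisson extension at a site `y` with `1 ≤ y₁`, `8 (y₁ + 2) ≤ 7N`:
`|u(y + e_k) - u(y)| ≤ (K / N²) ∑ |φ|`. [folklore] -/
theorem abs_topExtension_step_le {N : ℕ} (φ : ℤ → ℝ) {y : Site 2} (hy1 : 1 ≤ y 1)
    (hy8 : 8 * (y 1 + 2) ≤ 7 * (N : ℤ)) (k : Fin 4) :
    |topExtension N φ (y + cornerUnit k) - topExtension N φ y| ≤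
      topGradConst / N ^ 2 * ∑ i ∈ Ico 1 N, |φ i| := by
  have hT0 : 0 ≤ ∑ i ∈ Ico 1 N, |φ i| := Finset.sum_nonneg fun i _ => abs_nonneg _
  have hL := linGeomConst_pos
  have hsl := sinhLower_pos
  -- the horizontal constant is dominated by the vertical one
  have hdom : 2 * π * linGeomConst / N ^ 2 * ∑ i ∈ Ico 1 N, |φ i| ≤
      topGradConst / N ^ 2 * ∑ i ∈ Ico 1 N, |φ i| := by
    refine mul_le_mul_of_nonneg_right ?_ hT0
    refine div_le_div_of_nonneg_right ?_ (by positivity)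
    unfold topGradConst
    rw [le_div_iff₀ hsl]
    have h2 : 2 * π * linGeomConst * sinhLower ≤ 2 * π * linGeomConst * (1 / 2) :=
      mul_le_mul_of_nonneg_left sinhLower_le (by positivity)
    have h3 : 0 < 2 * π * linGeomConst := by positivity
    linarith
  have hvert : ∀ z : Site 2, 0 ≤ z 1 → 8 * (z 1 + 1) ≤ 7 * (N : ℤ) →
      |topExtension N φ (z + cornerUnit 1) - topExtension N φ z| ≤ topGradConst / N ^ 2 * ∑ i ∈ Ico 1 N, |φ i| := by
    intro z hz0 hz8
    have := abs_topExtension_add_cornerUnit_one_sub_le φ hz0 hz8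
    unfold topGradConst
    exact this
  have hhor : ∀ z : Site 2, 0 ≤ z 1 → 8 * z 1 ≤ 7 * (N : ℤ) →
      |topExtension N φ (z + cornerUnit 0) - topExtension N φ z| ≤ topGradConst / N ^ 2 * ∑ i ∈ Ico 1 N, |φ i| :=
    fun z hz0 hz8 => (abs_topExtension_add_cornerUnit_zero_sub_le φ hz0 hz8).trans hdom
  rcases fin4_cases k with rfl | rfl | rfl | rfl
  · exact hhor y (by linarith) (by linarith)
  · exact hvert y (by linarith) (by linarith)
  · -- `y + e₂ = (y - e₀)`, `y = (y - e₀) + e₀`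
    have e2 : y + cornerUnit 2 = y - cornerUnit 0 := by
      rw [show (2 : Fin 4) = 0 + 2 from rfl, cornerUnit_add_two, sub_eq_add_neg]
    have := hhor (y - cornerUnit 0) (by simp [cornerUnit]; linarith) (by simp [cornerUnit]; linarith)
    rw [sub_add_cancel] at this
    rw [e2, abs_sub_comm]
    exact this
  · have e3 : y + cornerUnit 3 = y - cornerUnit 1 := by
      rw [show (3 : Fin 4) = 1 + 2 from rfl, cornerUnit_add_two, sub_eq_add_neg]
    have := hvert (y - cornerUnit 1) (by simp [cornerUnit]; linarith) (by simp [cornerUnit]; linarith)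
    rw [sub_add_cancel] at this
    rw [e3, abs_sub_comm]
    exact this

/-! ### Lattice motions -/

/-- A map `σ : ℤ² → ℤ²` is a **lattice motion** if it maps lattice steps to lattice steps, up to a
fixed permutation of the four directions (translations composed with the symmetries of the
square). The Laplacian commutes with such maps. [folklore] -/
def IsLatticeMotion (σ : Site 2 → Site 2) : Prop :=
  ∃ perm : Equiv.Perm (Fin 4), ∀ x k, σ (x + cornerUnit k) = σ x + cornerUnit (perm k)

/-- The Laplacian commutes with lattice motions. [folklore] -/
theorem IsLatticeMotion.latticeLaplacian_comp {σ : Site 2 → Site 2} (hσ : IsLatticeMotion σ)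
    (u : Site 2 → ℝ) (x : Site 2) :
    latticeLaplacian (fun y => u (σ y)) x = latticeLaplacian u (σ x) := by
  obtain ⟨perm, hperm⟩ := hσ
  simp only [latticeLaplacian_eq, hperm]
  congr 1
  exact Equiv.sum_comp perm (fun k => u (σ x + cornerUnit k))

/-- Lattice motions transport lattice steps. [folklore] -/
theorem IsLatticeMotion.exists_step {σ : Site 2 → Site 2} (hσ : IsLatticeMotion σ) (x : Site 2) (k : Fin 4) :
    ∃ k' : Fin 4, σ (x + cornerUnit k) = σ x + cornerUnit k' := by
  obtain ⟨perm, hperm⟩ := hσ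
  exact ⟨perm k, hperm x k⟩

/-! ### The four Poisson extensions of a box and the representation formula -/

section Box

variable (a : Site 2) (N : ℕ) (h : Site 2 → ℝ)

/-- The open lattice box `(a₀, a₀ + N) × (a₁, a₁ + N)` (interior sites). [folklore] -/
def boxInterior : Set (Site 2) := {x | a 0 < x 0 ∧ x 0 < a 0 + N ∧ a 1 < x 1 ∧ x 1 < a 1 + N}

/-- The box map of the top side: `x ↦ x - a`. [folklore] -/
def boxMapTop (x : Site 2) : Site 2 := ![x 0 - a 0, x 1 - a 1]
/-- The box map of the bottom side: `x ↦ (x₀ - a₀, N - (x₁ - a₁))`. [folklore] -/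
def boxMapBottom (x : Site 2) : Site 2 := ![x 0 - a 0, N - (x 1 - a 1)]
/-- The box map of the left side: `x ↦ (x₁ - a₁, N - (x₀ - a₀))`. [folklore] -/
def boxMapLeft (x : Site 2) : Site 2 := ![x 1 - a 1, N - (x 0 - a 0)]
/-- The box map of the right side: `x ↦ (x₁ - a₁, x₀ - a₀)`. [folklore] -/
def boxMapRight (x : Site 2) : Site 2 := ![x 1 - a 1, x 0 - a 0]

/-- The top box map is a lattice motion (identity permutation). [folklore] -/
theorem isLatticeMotion_boxMapTop : IsLatticeMotion (boxMapTop a) :=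
  ⟨Equiv.refl _, fun x k => by
    ext i; fin_cases i <;> fin_cases k <;> simp [boxMapTop, cornerUnit] <;> ring⟩

/-- The bottom box map is a lattice motion (swapping north and south). [folklore] -/
theorem isLatticeMotion_boxMapBottom : IsLatticeMotion (boxMapBottom a N) :=
  ⟨Equiv.swap 1 3, fun x k => by
    ext i; fin_cases i <;> fin_cases k <;> simp [boxMapBottom, cornerUnit, Equiv.swap_apply_def] <;> ring⟩

/-- The left box map is a lattice motion (a quarter turn of the directions). [folklore] -/
theorem isLatticeMotion_boxMapLeft : IsLatticeMotion (boxMapLeft a N) :=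
  ⟨Equiv.addRight 3, fun x k => by
    ext i; fin_cases i <;> fin_cases k <;> simp [boxMapLeft, cornerUnit] <;> ring⟩

/-- The right box map is a lattice motion (transposition of the axes). [folklore] -/
theorem isLatticeMotion_boxMapRight : IsLatticeMotion (boxMapRight a) :=
  ⟨(Equiv.swap 0 1).trans (Equiv.swap 2 3), fun x k => by
    ext i; fin_cases i <;> fin_cases k <;> simp [boxMapRight, cornerUnit, Equiv.swap_apply_def] <;> ring⟩

/-- The Poisson extension of the top-side values of `h`. [folklore] -/
def boxTop (x : Site 2) : ℝ := topExtension N (fun i => h ![a 0 + i, a 1 + N]) (boxMapTop a x)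
/-- The Poisson extension of the bottom-side values of `h`. [folklore] -/
def boxBottom (x : Site 2) : ℝ := topExtension N (fun i => h ![a 0 + i, a 1]) (boxMapBottom a N x)
/-- The Poisson extension of the left-side values of `h`. [folklore] -/
def boxLeft (x : Site 2) : ℝ := topExtension N (fun j => h ![a 0, a 1 + j]) (boxMapLeft a N x)
/-- The Poisson extension of the right-side values of `h`. [folklore] -/
def boxRight (x : Site 2) : ℝ := topExtension N (fun j => h ![a 0 + N, a 1 + j]) (boxMapRight a x)

/-- **The Poisson extension of the box**: the sum of the four side extensions; lattice-harmonic on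
all of `ℤ²` and equal to `h` on the four open sides of the box. [folklore] -/
def boxPoisson (x : Site 2) : ℝ := boxTop a N h x + boxBottom a N h x + boxLeft a N h x + boxRight a N h x

/-- The Poisson extension of the box is lattice-harmonic everywhere. [folklore] -/
theorem latticeLaplacian_boxPoisson (x : Site 2) : latticeLaplacian (boxPoisson a N h) x = 0 := by
  have e : boxPoisson a N h = boxTop a N h + boxBottom a N h + boxLeft a N h + boxRight a N h := rfl
  rw [e, latticeLaplacian_add, latticeLaplacian_add, latticeLaplacian_add]
  have h1 : latticeLaplacian (boxTop a N h) x = 0 := by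
    unfold boxTop
    rw [(isLatticeMotion_boxMapTop a).latticeLaplacian_comp, latticeLaplacian_topExtension]
  have h2 : latticeLaplacian (boxBottom a N h) x = 0 := by
    unfold boxBottom
    rw [(isLatticeMotion_boxMapBottom a N).latticeLaplacian_comp, latticeLaplacian_topExtension]
  have h3 : latticeLaplacian (boxLeft a N h) x = 0 := by
    unfold boxLeft
    rw [(isLatticeMotion_boxMapLeft a N).latticeLaplacian_comp, latticeLaplacian_topExtension]
  have h4 : latticeLaplacian (boxRight a N h) x = 0 := by
    unfold boxRight
    rw [(isLatticeMotion_boxMapRight a).latticeLaplacian_comp, latticeLaplacian_topExtension]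
  rw [h1, h2, h3, h4]; ring

/-- **The outer boundary of the box interior consists of the four open sides.** [folklore] -/
theorem mem_sides_of_mem_latticeOuterBoundary {a : Site 2} {N : ℕ} {w : Site 2}
    (hw : w ∈ latticeOuterBoundary (boxInterior a N)) :
    (∃ i : ℕ, 0 < i ∧ i < N ∧ w = ![a 0 + i, a 1 + N]) ∨ (∃ i : ℕ, 0 < i ∧ i < N ∧ w = ![a 0 + i, a 1]) ∨
    (∃ j : ℕ, 0 < j ∧ j < N ∧ w = ![a 0, a 1 + j]) ∨ (∃ j : ℕ, 0 < j ∧ j < N ∧ w = ![a 0 + N, a 1 + j]) := by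
  obtain ⟨hwS, v, hv, k, rfl⟩ := hw
  obtain ⟨h0, h0', h1, h1'⟩ := hv
  simp only [boxInterior, Set.mem_setOf_eq, not_and, not_lt] at hwS
  have hw0 : (v + cornerUnit k) 0 = v 0 + cornerUnit k 0 := rfl
  have hw1 : (v + cornerUnit k) 1 = v 1 + cornerUnit k 1 := rfl
  fin_cases k
  · -- east: right side
    right; right; right
    refine ⟨(v 1 - a 1).toNat, by omega, by omega, ?_⟩
    have := hwS (by simp [cornerUnit]; omega)
    simp [cornerUnit] at this
    ext i; fin_cases i <;> simp [cornerUnit] <;> omega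
  · -- north: top side
    left
    refine ⟨(v 0 - a 0).toNat, by omega, by omega, ?_⟩
    have := hwS (by simp [cornerUnit]; omega) (by simp [cornerUnit]; omega) (by simp [cornerUnit]; omega)
    simp [cornerUnit] at this
    ext i; fin_cases i <;> simp [cornerUnit] <;> omega
  · -- west: left side
    right; right; left
    refine ⟨(v 1 - a 1).toNat, by omega, by omega, ?_⟩
    by_contra hne
    have := hwS ?_
    · simp [cornerUnit] at this; omega
    · simp [cornerUnit]
      by_contra hle
      apply hne
      ext i; fin_cases i <;> simp [cornerUnit] <;> omega
  · -- south: bottom side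
    right; left
    refine ⟨(v 0 - a 0).toNat, by omega, by omega, ?_⟩
    by_contra hne
    have := hwS (by simp [cornerUnit]; omega) (by simp [cornerUnit]; omega) ?_
    · simp [cornerUnit] at this; omega
    · simp [cornerUnit]
      by_contra hle
      apply hne
      ext i; fin_cases i <;> simp [cornerUnit] <;> omega

/-- `boxPoisson = h` on the open top side. [folklore] -/
theorem boxPoisson_top {i : ℕ} (hi : 0 < i) (hiN : i < N) :
    boxPoisson a N h ![a 0 + i, a 1 + N] = h ![a 0 + i, a 1 + N] := by
  unfold boxPoisson boxTop boxBottom boxLeft boxRight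
  rw [topExtension_top _ hi hiN (x := boxMapTop a ![a 0 + i, a 1 + N]) (by simp [boxMapTop]) (by simp [boxMapTop]),
    topExtension_bottom _ (x := boxMapBottom a N ![a 0 + i, a 1 + N]) (by simp [boxMapBottom]),
    topExtension_right _ (x := boxMapLeft a N ![a 0 + i, a 1 + N]) (by simp [boxMapLeft]),
    topExtension_right _ (x := boxMapRight a ![a 0 + i, a 1 + N]) (by simp [boxMapRight])]
  ring

/-- `boxPoisson = h` on the open bottom side. [folklore] -/
theorem boxPoisson_bottom {i : ℕ} (hi : 0 < i) (hiN : i < N) :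
    boxPoisson a N h ![a 0 + i, a 1] = h ![a 0 + i, a 1] := by
  unfold boxPoisson boxTop boxBottom boxLeft boxRight
  rw [topExtension_bottom _ (x := boxMapTop a ![a 0 + i, a 1]) (by simp [boxMapTop]),
    topExtension_top _ hi hiN (x := boxMapBottom a N ![a 0 + i, a 1]) (by simp [boxMapBottom]) (by simp [boxMapBottom]),
    topExtension_left _ (x := boxMapLeft a N ![a 0 + i, a 1]) (by simp [boxMapLeft]),
    topExtension_left _ (x := boxMapRight a ![a 0 + i, a 1]) (by simp [boxMapRight])]
  ring

/-- `boxPoisson = h` on the open left side. [folklore] -/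
theorem boxPoisson_left {j : ℕ} (hj : 0 < j) (hjN : j < N) :
    boxPoisson a N h ![a 0, a 1 + j] = h ![a 0, a 1 + j] := by
  unfold boxPoisson boxTop boxBottom boxLeft boxRight
  rw [topExtension_left _ (x := boxMapTop a ![a 0, a 1 + j]) (by simp [boxMapTop]),
    topExtension_left _ (x := boxMapBottom a N ![a 0, a 1 + j]) (by simp [boxMapBottom]),
    topExtension_top _ hj hjN (x := boxMapLeft a N ![a 0, a 1 + j]) (by simp [boxMapLeft]) (by simp [boxMapLeft]),
    topExtension_bottom _ (x := boxMapRight a ![a 0, a 1 + j]) (by simp [boxMapRight])]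
  ring

/-- `boxPoisson = h` on the open right side. [folklore] -/
theorem boxPoisson_right {j : ℕ} (hj : 0 < j) (hjN : j < N) :
    boxPoisson a N h ![a 0 + N, a 1 + j] = h ![a 0 + N, a 1 + j] := by
  unfold boxPoisson boxTop boxBottom boxLeft boxRight
  rw [topExtension_right _ (x := boxMapTop a ![a 0 + N, a 1 + j]) (by simp [boxMapTop]),
    topExtension_right _ (x := boxMapBottom a N ![a 0 + N, a 1 + j]) (by simp [boxMapBottom]),
    topExtension_bottom _ (x := boxMapLeft a N ![a 0 + N, a 1 + j]) (by simp [boxMapLeft]),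
    topExtension_top _ hj hjN (x := boxMapRight a ![a 0 + N, a 1 + j]) (by simp [boxMapRight]) (by simp [boxMapRight])]
  ring

/-- `boxPoisson = h` on the outer boundary of the box interior. [folklore] -/
theorem boxPoisson_eq_of_mem_latticeOuterBoundary {w : Site 2} (hw : w ∈ latticeOuterBoundary (boxInterior a N)) :
    boxPoisson a N h w = h w := by
  rcases mem_sides_of_mem_latticeOuterBoundary hw with ⟨i, hi, hiN, rfl⟩ | ⟨i, hi, hiN, rfl⟩ |
    ⟨j, hj, hjN, rfl⟩ | ⟨j, hj, hjN, rfl⟩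
  · exact boxPoisson_top a N h hi hiN
  · exact boxPoisson_bottom a N h hi hiN
  · exact boxPoisson_left a N h hj hjN
  · exact boxPoisson_right a N h hj hjN

/-- The box interior is finite. [folklore] -/
theorem boxInterior_finite : (boxInterior a N).Finite := by
  have hfin : ((Set.Icc (a 0) (a 0 + N)) ×ˢ (Set.Icc (a 1) (a 1 + N))).Finite :=
    (Set.finite_Icc _ _).prod (Set.finite_Icc _ _)
  refine (hfin.preimage (f := fun x : Site 2 => (x 0, x 1)) ?_).subset ?_
  · intro x _ y _ hxy
    simp only [Prod.mk.injEq] at hxy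
    ext i; fin_cases i
    · exact hxy.1
    · exact hxy.2
  · intro x hx
    obtain ⟨h0, h0', h1, h1'⟩ := hx
    simp only [Set.mem_preimage, Set.mem_prod, Set.mem_Icc]
    omega

/-- **Poisson representation on the box.** A function harmonic on the box interior equals the
Poisson extension of its side values there. [folklore] -/
theorem eqOn_boxPoisson {h : Site 2 → ℝ} (hh : IsLatticeHarmonicOn h (boxInterior a N)) :
    Set.EqOn h (boxPoisson a N h) (boxInterior a N) :=
  isLatticeHarmonicOn_unique (boxInterior_finite a N) hh (fun x _ => latticeLaplacian_boxPoisson a N h x)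
    fun _ hw => (boxPoisson_eq_of_mem_latticeOuterBoundary a N h hw).symm

/-! ### Interior estimates -/

/-- The **boundary sum** `∑_{sides} |h|` over the four open sides of the box. [folklore] -/
def boxBoundarySum : ℝ :=
  ∑ i ∈ Ico 1 N, (|h ![a 0 + i, a 1 + N]| + |h ![a 0 + i, a 1]| + |h ![a 0, a 1 + i]| + |h ![a 0 + N, a 1 + i]|)

/-- The boundary sum is nonnegative. [folklore] -/
theorem boxBoundarySum_nonneg : 0 ≤ boxBoundarySum a N h :=
  Finset.sum_nonneg fun i _ => by positivity

/-- The **middle region** of the box: sites with `N/4 ≤ x_i - a_i ≤ 3N/4`. [folklore] -/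
def boxMiddle : Set (Site 2) :=
  {x | (N : ℤ) ≤ 4 * (x 0 - a 0) ∧ 4 * (x 0 - a 0) ≤ 3 * N ∧ (N : ℤ) ≤ 4 * (x 1 - a 1) ∧ 4 * (x 1 - a 1) ≤ 3 * N}

variable {a N}

/-- The middle region lies in the interior (`N ≥ 4`). [folklore] -/
theorem boxMiddle_subset_boxInterior (hN : 4 ≤ N) : boxMiddle a N ⊆ boxInterior a N := by
  intro x hx
  obtain ⟨h0, h0', h1, h1'⟩ := hx
  refine ⟨?_, ?_, ?_, ?_⟩ <;> omega

/-- Neighbours of middle sites are interior (`N ≥ 8`). [folklore] -/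
theorem add_cornerUnit_mem_boxInterior_of_mem_boxMiddle (hN : 8 ≤ N) {x : Site 2} (hx : x ∈ boxMiddle a N)
    (k : Fin 4) : x + cornerUnit k ∈ boxInterior a N := by
  obtain ⟨h0, h0', h1, h1'⟩ := hx
  have hk0 : (x + cornerUnit k) 0 = x 0 + cornerUnit k 0 := rfl
  have hk1 : (x + cornerUnit k) 1 = x 1 + cornerUnit k 1 := rfl
  rcases fin4_cases k with rfl | rfl | rfl | rfl <;>
    simp only [boxInterior, Set.mem_setOf_eq, cornerUnit] <;> simp <;> omega

variable (a N)

/-- **Sup bound for the Poisson extension** on the middle region: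
`|P h (x)| ≤ (2 C_g / N) · boxBoundarySum`. [folklore] -/
theorem abs_boxPoisson_le {x : Site 2} (hx : x ∈ boxMiddle a N) :
    |boxPoisson a N h x| ≤ 2 * geomConst / N * boxBoundarySum a N h := by
  obtain ⟨h0, h0', h1, h1'⟩ := hx
  unfold boxPoisson boxBoundarySum
  simp only [Finset.sum_add_distrib, mul_add]
  have hT := abs_topExtension_le (N := N) (fun i => h ![a 0 + i, a 1 + N]) (x := boxMapTop a x)
    (by simp [boxMapTop]; omega) (by simp [boxMapTop]; omega)
  have hB := abs_topExtension_le (N := N) (fun i => h ![a 0 + i, a 1]) (x := boxMapBottom a N x)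
    (by simp [boxMapBottom]; omega) (by simp [boxMapBottom]; omega)
  have hL := abs_topExtension_le (N := N) (fun j => h ![a 0, a 1 + j]) (x := boxMapLeft a N x)
    (by simp [boxMapLeft]; omega) (by simp [boxMapLeft]; omega)
  have hR := abs_topExtension_le (N := N) (fun j => h ![a 0 + N, a 1 + j]) (x := boxMapRight a x)
    (by simp [boxMapRight]; omega) (by simp [boxMapRight]; omega)
  unfold boxTop boxBottom boxLeft boxRight
  set T0 := topExtension N (fun i => h ![a 0 + i, a 1 + N]) (boxMapTop a x)
  set B0 := topExtension N (fun i => h ![a 0 + i, a 1]) (boxMapBottom a N x)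
  set L0 := topExtension N (fun j => h ![a 0, a 1 + j]) (boxMapLeft a N x)
  set R0 := topExtension N (fun j => h ![a 0 + N, a 1 + j]) (boxMapRight a x)
  have e1 := abs_add_le (T0 + B0 + L0) R0
  have e2 := abs_add_le (T0 + B0) L0
  have e3 := abs_add_le T0 B0
  linarith

/-- **Increment bound for the Poisson extension** on the middle region (`N ≥ 16`):
`|P h (x + e_k) - P h (x)| ≤ (K / N²) · boxBoundarySum`. [folklore] -/
theorem abs_boxPoisson_step_le (hN : 16 ≤ N) {x : Site 2} (hx : x ∈ boxMiddle a N) (k : Fin 4) :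
    |boxPoisson a N h (x + cornerUnit k) - boxPoisson a N h x| ≤ topGradConst / N ^ 2 * boxBoundarySum a N h := by
  obtain ⟨h0, h0', h1, h1'⟩ := hx
  unfold boxPoisson boxBoundarySum
  simp only [Finset.sum_add_distrib, mul_add]
  obtain ⟨kT, hkT⟩ := (isLatticeMotion_boxMapTop a).exists_step x k
  obtain ⟨kB, hkB⟩ := (isLatticeMotion_boxMapBottom a N).exists_step x k
  obtain ⟨kL, hkL⟩ := (isLatticeMotion_boxMapLeft a N).exists_step x k
  obtain ⟨kR, hkR⟩ := (isLatticeMotion_boxMapRight a).exists_step x k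
  have hT := abs_topExtension_step_le (N := N) (fun i => h ![a 0 + i, a 1 + N]) (y := boxMapTop a x)
    (by simp [boxMapTop]; omega) (by simp [boxMapTop]; omega) kT
  have hB := abs_topExtension_step_le (N := N) (fun i => h ![a 0 + i, a 1]) (y := boxMapBottom a N x)
    (by simp [boxMapBottom]; omega) (by simp [boxMapBottom]; omega) kB
  have hL := abs_topExtension_step_le (N := N) (fun j => h ![a 0, a 1 + j]) (y := boxMapLeft a N x)
    (by simp [boxMapLeft]; omega) (by simp [boxMapLeft]; omega) kL
  have hR := abs_topExtension_step_le (N := N) (fun j => h ![a 0 + N, a 1 + j]) (y := boxMapRight a x)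
    (by simp [boxMapRight]; omega) (by simp [boxMapRight]; omega) kR
  unfold boxTop boxBottom boxLeft boxRight
  rw [hkT, hkB, hkL, hkR]
  set T1 := topExtension N (fun i => h ![a 0 + i, a 1 + N]) (boxMapTop a x + cornerUnit kT)
  set T0 := topExtension N (fun i => h ![a 0 + i, a 1 + N]) (boxMapTop a x)
  set B1 := topExtension N (fun i => h ![a 0 + i, a 1]) (boxMapBottom a N x + cornerUnit kB)
  set B0 := topExtension N (fun i => h ![a 0 + i, a 1]) (boxMapBottom a N x)
  set L1 := topExtension N (fun j => h ![a 0, a 1 + j]) (boxMapLeft a N x + cornerUnit kL)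
  set L0 := topExtension N (fun j => h ![a 0, a 1 + j]) (boxMapLeft a N x)
  set R1 := topExtension N (fun j => h ![a 0 + N, a 1 + j]) (boxMapRight a x + cornerUnit kR)
  set R0 := topExtension N (fun j => h ![a 0 + N, a 1 + j]) (boxMapRight a x)
  have e : T1 + B1 + L1 + R1 - (T0 + B0 + L0 + R0) = (T1 - T0) + (B1 - B0) + (L1 - L0) + (R1 - R0) := by ring
  rw [e]
  have e1 := abs_add_le (T1 - T0 + (B1 - B0) + (L1 - L0)) (R1 - R0)
  have e2 := abs_add_le (T1 - T0 + (B1 - B0)) (L1 - L0)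
  have e3 := abs_add_le (T1 - T0) (B1 - B0)
  linarith

/-- **Interior estimates for lattice-harmonic functions on a box.** If `h` is harmonic on the
interior of the box of side `N ≥ 16` with lower-left corner `a`, then at every site `x` of the
middle region, `|h x| ≤ (2 C_g / N) ∑_{sides} |h|` and `|h (x + e_k) - h x| ≤ (K / N²) ∑_{sides} |h|`
for all four directions `k` (discrete interior gradient estimate, Lawler–Limic 2010, Thm 6.3.8 /
Prop. 6.4.?; here from the explicit Poisson kernel of the box). [folklore] -/
theorem harmonic_box_estimates {h : Site 2 → ℝ} (hN : 16 ≤ N) (hh : IsLatticeHarmonicOn h (boxInterior a N))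
    {x : Site 2} (hx : x ∈ boxMiddle a N) :
    |h x| ≤ 2 * geomConst / N * boxBoundarySum a N h ∧
      ∀ k : Fin 4, |h (x + cornerUnit k) - h x| ≤ topGradConst / N ^ 2 * boxBoundarySum a N h := by
  have heq := eqOn_boxPoisson a N hh
  have hxI : x ∈ boxInterior a N := boxMiddle_subset_boxInterior (by omega) hx
  refine ⟨?_, fun k => ?_⟩
  · rw [heq hxI]; exact abs_boxPoisson_le a N h hx
  · rw [heq hxI, heq (add_cornerUnit_mem_boxInterior_of_mem_boxMiddle (by omega) hx k)]
    exact abs_boxPoisson_step_le a N h hN hx k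

/-- The boundary sum under a uniform bound on the sides: `∑_{sides} |h| ≤ 4 N M`. [folklore] -/
theorem boxBoundarySum_le_of_forall_le {M : ℝ} (hM0 : 0 ≤ M)
    (hM : ∀ i : ℕ, 0 < i → i < N →
      |h ![a 0 + i, a 1 + N]| ≤ M ∧ |h ![a 0 + i, a 1]| ≤ M ∧ |h ![a 0, a 1 + i]| ≤ M ∧ |h ![a 0 + N, a 1 + i]| ≤ M) :
    boxBoundarySum a N h ≤ 4 * N * M := by
  unfold boxBoundarySum
  calc _ ≤ ∑ i ∈ Ico 1 N, 4 * M := Finset.sum_le_sum fun i hi => by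
          obtain ⟨h1, h2, h3, h4⟩ := hM i (Finset.mem_Ico.1 hi).1 (Finset.mem_Ico.1 hi).2
          linarith
    _ = (N - 1 : ℕ) * (4 * M) := by rw [Finset.sum_const, Nat.card_Ico, nsmul_eq_mul]
    _ ≤ 4 * N * M := by
        rcases Nat.eq_zero_or_pos N with rfl | hN
        · simp
        · rw [Nat.cast_sub hN]; push_cast; nlinarith

/-- **Interior gradient estimate under a uniform bound**: `|h (x + e_k) - h x| ≤ 4 K M / N` on the
middle region if `|h| ≤ M` on the four open sides (`N ≥ 16`). [folklore] -/
theorem harmonic_box_gradient_le {h : Site 2 → ℝ} (hN : 16 ≤ N) (hh : IsLatticeHarmonicOn h (boxInterior a N))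
    {M : ℝ} (hM0 : 0 ≤ M) (hM : ∀ i : ℕ, 0 < i → i < N →
      |h ![a 0 + i, a 1 + N]| ≤ M ∧ |h ![a 0 + i, a 1]| ≤ M ∧ |h ![a 0, a 1 + i]| ≤ M ∧ |h ![a 0 + N, a 1 + i]| ≤ M)
    {x : Site 2} (hx : x ∈ boxMiddle a N) (k : Fin 4) :
    |h (x + cornerUnit k) - h x| ≤ 4 * topGradConst * M / N := by
  have h1 := ((harmonic_box_estimates a N hN hh hx).2 k).trans
    (mul_le_mul_of_nonneg_left (boxBoundarySum_le_of_forall_le a N h hM0 hM)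
      (div_nonneg topGradConst_pos.le (by positivity)))
  have hNr : (0 : ℝ) < N := by exact_mod_cast (show 0 < N by omega)
  calc _ ≤ topGradConst / N ^ 2 * (4 * N * M) := h1
    _ = 4 * topGradConst * M / N := by field_simp

end Box

/-! ### Averaging over concentric boxes: an `L¹` interior estimate -/

section Average

/-- The lower-left corner of the box of radius `n` centred at `x`. [folklore] -/
def cornerOf (x : Site 2) (n : ℕ) : Site 2 := ![x 0 - n, x 1 - n]

/-- `x` lies in the middle region of the box of radius `n` centred at `x`. [folklore] -/
theorem mem_boxMiddle_cornerOf (x : Site 2) (n : ℕ) : x ∈ boxMiddle (cornerOf x n) (2 * n) := by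
  simp only [boxMiddle, cornerOf, Set.mem_setOf_eq]
  simp; omega

/-- **`L¹` interior estimate by averaging over radii.** If `h` is harmonic on the interiors of the
boxes of radii `n ∈ [n₁, n₂)` centred at `x` (`n₁ ≥ 8`) and `Q` contains the sides of all these
boxes, then `(n₂ - n₁) |h x| ≤ (4 C_g / n₁) ∑_{y ∈ Q} |h y|`: the boundary-sum bound of
`harmonic_box_estimates` summed over the radii, the four families of side points being embedded
injectively in `Q`. [folklore] -/
theorem sub_mul_abs_le_sum {x : Site 2} {n₁ n₂ : ℕ} (hn₁ : 8 ≤ n₁) {h : Site 2 → ℝ}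
    (hh : ∀ n ∈ Ico n₁ n₂, IsLatticeHarmonicOn h (boxInterior (cornerOf x n) (2 * n)))
    (Q : Finset (Site 2))
    (hQ : ∀ n ∈ Ico n₁ n₂, ∀ i ∈ Ico 1 (2 * n),
      (![x 0 - n + i, x 1 + n] : Site 2) ∈ Q ∧ (![x 0 - n + i, x 1 - n] : Site 2) ∈ Q ∧
      (![x 0 - n, x 1 - n + i] : Site 2) ∈ Q ∧ (![x 0 + n, x 1 - n + i] : Site 2) ∈ Q) :
    ((n₂ - n₁ : ℕ) : ℝ) * |h x| ≤ 4 * geomConst / n₁ * ∑ y ∈ Q, |h y| := by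
  have hg := geomConst_pos
  -- one radius
  have hone : ∀ n ∈ Ico n₁ n₂, |h x| ≤ geomConst / n₁ * boxBoundarySum (cornerOf x n) (2 * n) h := by
    intro n hn
    have hn1 : n₁ ≤ n := (Finset.mem_Ico.1 hn).1
    have h16 : 16 ≤ 2 * n := by omega
    have := (harmonic_box_estimates (cornerOf x n) (2 * n) h16 (hh n hn) (mem_boxMiddle_cornerOf x n)).1
    refine this.trans (mul_le_mul_of_nonneg_right ?_ (boxBoundarySum_nonneg _ _ _))
    have hnr : (0 : ℝ) < n := by exact_mod_cast (show 0 < n by omega)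
    have hn1r : (0 : ℝ) < n₁ := by exact_mod_cast (show 0 < n₁ by omega)
    rw [div_le_div_iff₀ (by positivity) hn1r]
    push_cast
    have : (n₁ : ℝ) ≤ n := by exact_mod_cast hn1
    nlinarith
  -- sum over the radii
  have hsum : ((n₂ - n₁ : ℕ) : ℝ) * |h x| ≤ geomConst / n₁ * ∑ n ∈ Ico n₁ n₂, boxBoundarySum (cornerOf x n) (2 * n) h := by
    rw [Finset.mul_sum]
    have := Finset.sum_le_sum hone
    rwa [Finset.sum_const, Nat.card_Ico, nsmul_eq_mul] at this
  refine hsum.trans ?_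
  rw [show 4 * geomConst / n₁ * ∑ y ∈ Q, |h y| = geomConst / n₁ * (4 * ∑ y ∈ Q, |h y|) by ring]
  refine mul_le_mul_of_nonneg_left ?_ (by positivity)
  -- the four families of side points
  have key : ∀ g : (Σ _ : ℕ, ℕ) → Site 2,
      (∀ n ∈ Ico n₁ n₂, ∀ i ∈ Ico 1 (2 * n), g ⟨n, i⟩ ∈ Q) →
      Set.InjOn g ((Ico n₁ n₂).sigma fun n => Ico 1 (2 * n)) →
      ∑ n ∈ Ico n₁ n₂, ∑ i ∈ Ico 1 (2 * n), |h (g ⟨n, i⟩)| ≤ ∑ y ∈ Q, |h y| := by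
    intro g hgQ hginj
    rw [← Finset.sum_sigma (Ico n₁ n₂) (fun n => Ico 1 (2 * n)) (fun p => |h (g p)|),
      ← Finset.sum_image (f := fun y => |h y|) hginj]
    refine Finset.sum_le_sum_of_subset_of_nonneg ?_ fun y _ _ => abs_nonneg _
    intro y hy
    obtain ⟨⟨n, i⟩, hni, rfl⟩ := Finset.mem_image.1 hy
    obtain ⟨hn, hi⟩ := Finset.mem_sigma.1 hni
    exact hgQ n hn i hi
  have eT := key (fun p => ![x 0 - p.1 + p.2, x 1 + p.1]) (fun n hn i hi => (hQ n hn i hi).1) ?_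
  have eB := key (fun p => ![x 0 - p.1 + p.2, x 1 - p.1]) (fun n hn i hi => (hQ n hn i hi).2.1) ?_
  have eL := key (fun p => ![x 0 - p.1, x 1 - p.1 + p.2]) (fun n hn i hi => (hQ n hn i hi).2.2.1) ?_
  have eR := key (fun p => ![x 0 + p.1, x 1 - p.1 + p.2]) (fun n hn i hi => (hQ n hn i hi).2.2.2) ?_
  · unfold boxBoundarySum
    simp only [Finset.sum_add_distrib]
    have e1 : ∀ n ∈ Ico n₁ n₂, ∑ i ∈ Ico 1 (2 * n), |h ![cornerOf x n 0 + i, cornerOf x n 1 + (2 * n : ℕ)]| =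
        ∑ i ∈ Ico 1 (2 * n), |h ![x 0 - n + i, x 1 + n]| := fun n _ => Finset.sum_congr rfl fun i _ => by
      congr 2; ext j; fin_cases j <;> simp [cornerOf]; ring
    have e2 : ∀ n ∈ Ico n₁ n₂, ∑ i ∈ Ico 1 (2 * n), |h ![cornerOf x n 0 + i, cornerOf x n 1]| =
        ∑ i ∈ Ico 1 (2 * n), |h ![x 0 - n + i, x 1 - n]| := fun n _ => Finset.sum_congr rfl fun i _ => by
      rfl
    have e3 : ∀ n ∈ Ico n₁ n₂, ∑ i ∈ Ico 1 (2 * n), |h ![cornerOf x n 0, cornerOf x n 1 + i]| =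
        ∑ i ∈ Ico 1 (2 * n), |h ![x 0 - n, x 1 - n + i]| := fun n _ => Finset.sum_congr rfl fun i _ => by
      rfl
    have e4 : ∀ n ∈ Ico n₁ n₂, ∑ i ∈ Ico 1 (2 * n), |h ![cornerOf x n 0 + (2 * n : ℕ), cornerOf x n 1 + i]| =
        ∑ i ∈ Ico 1 (2 * n), |h ![x 0 + n, x 1 - n + i]| := fun n _ => Finset.sum_congr rfl fun i _ => by
      congr 2; ext j; fin_cases j <;> simp [cornerOf]; ring
    rw [Finset.sum_congr rfl e1, Finset.sum_congr rfl e2, Finset.sum_congr rfl e3, Finset.sum_congr rfl e4]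
    linarith
  all_goals
    rintro ⟨n, i⟩ hni ⟨n', i'⟩ hni' heq
    simp only [Finset.coe_sigma, Set.mem_sigma_iff, Finset.mem_coe, Finset.mem_Ico] at hni hni'
    have h0 := congrFun heq 0
    have h1 := congrFun heq 1
    simp at h0 h1
    have hn : n = n' := by omega
    subst hn
    have hi : i = i' := by omega
    subst hi
    rfl

end Average

end Literature.Probability.LatticeModels
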